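/-
Copyright: lit-balaban cell, Phase-2 proof seat p33 (gen 12).  Statement-level skeleton of a published paper; no proof claims beyond
what the kernel checks below.
-/
import Literature.MathematicalPhysics.QuantumFieldTheory.BalabanImbrieJaffe1984to88.BIJ85RegionPropagatorsActualBg
import Literature.MathematicalPhysics.QuantumFieldTheory.Balaban1983to89.B4Thm112RegionAllF

/-!
# `BalabanImbrieJaffe1984to88.BIJ85RegionPropagatorsActualBgMembers` — T. Bałaban, J. Imbrie, A. Jaffe, *Renormalization of the Higgs
model: minimizers, propagators and the stability of mean field theory*, Commun. Math. Phys. **97** (1985) 299–329 [BalabanImbrieJaffe1985],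
Sect. 7.3 p. 326 [PDF 28], with [7] = T. Bałaban, *Regularity and decay of lattice Green's functions*, Commun. Math. Phys. **89** (1983)
571–597 [Balaban1983RegularityDecay], THEOREM p. 573 (1.9)–(1.12): **THE REGULARITY (HÖLDER) AND DECAY MEMBERS OF [7]'s THEOREM FOR
[7]'s PROPAGATORS `G_k(Ω, u_k)` AT THE ACTUAL BACKGROUND ON LOCAL REGIONS, FOR AN ARBITRARY SOURCE `f`** — file 5 after
`BIJ85RegionPropagatorsActualBg`.

statement-level skeleton of published theorems with citation tags; proofs where landed; nothing here is a claim about the Yang–Mills mass gap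

PDFs held: `paper:balaban1985-cmp97-bij-higgs-minimizers` (journal page = PDF page + 298), p. 326 [PDF 28]; `paper:balaban1983-cmp89-regularity-decay`
(journal page = PDF page + 570), pp. 572–575.  Both re-read this session (text layer).

CITATION HEADER (lean-in-tree rule).  Phase-2 file of the lit-balaban TYPED SKELETON (HOME `run/shared/lean/pub/lit-balaban/`), seat p33
gen 12 (unit `lit-balaban-p33-g12`); SKELETON row **C1.Eq7.3.1-7.3.2** (owner r15, referee ref-5) × **B4.Thm@573** (owner r01); HOME/GAPS.md
G-C1-05 ADDENDUM 9/11 «WHAT REMAINS»: *(a) the identification … and [7]'s Hölder/δG members (1.9), (1.11)–(1.12)*.  THE PRINTED TEXTS,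
verbatim.  [BalabanImbrieJaffe1985] p. 326: *"The propagators arising from Δ_k(u_k), under the restriction (7.3.1) on the gauge field, also
satisfy the regularity and decay estimates of [7]."*  [7] p. 573, Theorem: *"There exist constants δ₀ > 0, R₀ (e.g., R₀ = 2) such that for A
satisfying (1.7), arbitrary α, 0 < α < 1, and all e sufficiently small the following estimates hold: |(∇^η_A G_k(Ω,A)f)(x) − U(A(Γ_{x,x′}))
(∇^η_A G_k(Ω,A)f)(x′)| ≤ c_α exp(−δ₀ dist({x,x′}, supp f)) |x − x′|^α ‖f‖_∞ (1.9) … |(G_k(Ω,A)f)(x)|, |(∇^η_A G_k(Ω,A)f)(x)| ≤ c₀ exp(−δ₀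
dist(x, supp f))‖f‖_∞ (1.10) … δG_k(Ω,Ω₀,A) = G_k(Ω,A) − G_k(Ω₀,A) (1.11) satisfies the inequalities (1.9), (1.10) with the additional factor
exp(−δ₀dist(x,Ωᶜ) − δ₀dist(supp f,Ωᶜ)) (1.12)"*.

THE POINT OF THIS FILE.  File 4 (`BIJ85RegionPropagatorsActualBg`) showed that [7]'s region operator fed with the bond variables of the actual
background `u_k` on a region `Ω` inside a local box — `regionOp rot e Ω A'` at any logarithm field `A'` of `u_k` — is independent of `A'` and
is the orthogonal conjugate `𝒢H(Ω,A)𝒢ᵀ` of the operator at the smooth small gauge `A` of files 1–3, and transferred (1.8) and the value member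
of (1.10).  Here the covariant derivative `D^η_{A′,μ} = 𝒢D^η_{A,μ}𝒢ᵀ` (r01's `covDeriv_gauge` + a bond-local congruence) and the parallel
transporters `U(A′(Γ)) = 𝒢(x)U(A(Γ))𝒢(x′)ᵀ` along nearest-neighbour chains are conjugated as well, so that EVERY member of [7]'s Theorem
p. 573 that r01 has certified hypothesis-free on regions for regular `A` and an ARBITRARY source `f` (`B4Thm110RegionAllF`: (1.10) value and
derivative, (1.9) Hölder, (1.12) value; `B4Thm112RegionAllF`: (1.12) derivative and Hölder) transfers to `G_k(Ω, u_k)`, with the constant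
multiplied by `N² = 4` (sup norms rotated sitewise).

WHAT IS PROVED (0 `sorry`, standard axioms; theorems only, no definition, no named fact).
* §1 conjugation algebra (block-diagonal orthogonal `𝒢`): `abs_blockDiag_mulVec_apply_le`, `abs_gauge_mulVec_le`, `norm_blockDiagT_mulVec_le`,
  `blockDiagT_mulVec_apply`, `conj_deriv_green_mulVec` (`D′G′f = 𝒢(DG𝒢ᵀf)`), `holderExpr_conj`.
* §2 `covDeriv_congr_dir`, **`regionDeriv_gauge`** (`D^η_{A′,μ} = 𝒢_σ D^η_{A,μ} 𝒢_σᵀ` on a region, in component form, under the bond-local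
  link relation of file 4), **`transport_acBond_gauge`** (`U(A′(Γ)) = U(κσ(x))·U(A(Γ))·U(κσ(x_end))ᵀ` along a nearest-neighbour chain).
* §3 `exists_smooth_gauge_links` — files 1–3 repackaged on the tori `P.L = ℓ + 1`: the smooth gauge `A` of the actual background, regular
  (1.7) on `Ω` in r01's lattice units, and the link relation for EVERY logarithm field `A′` of `u_k` on `Ω`.
* §4 **`thm110_value_region_actualBg_allF`**, **`thm110_deriv_region_actualBg_allF`** — (1.10), value and derivative members, for
  `G_k(Ω, u_k)` at every logarithm field, arbitrary `f` vanishing off a set at `ℓ^∞`-distance `≥ D` from `x` (r01's `…_allF` shapes, `4c₀`).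
* §5 **`thm19_holder_region_actualBg_allF`** — (1.9), the HÖLDER member (the «regularity» estimate), all pairs `x ≠ x′` with the
  transporter along a nearest-neighbour contour, arbitrary `f`, for `G_k(Ω, u_k)` at every logarithm field (`4c₀`).
* §6 **`thm112_value_region_actualBg_allF`** — (1.11)–(1.12), value member, for the pair `Ω ⊂ Ω₀` inside the box: `δG_k(Ω, Ω₀, u_k)` at
  every logarithm field of `u_k` on `Ω₀` (`4c₀`).
* §7 **`thm112_deriv_region_actualBg_allF`**, **`thm112_holder_region_actualBg_allF`** — (1.11)–(1.12), derivative and Hölder members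
  (r01's `B4Thm112RegionAllF`), same pair, every logarithm field (`4c₀`); `gauge_pair_apply`, `gauge_holderPair` (the two-region
  conjugation identities).
HONEST SCOPE.  As in file 4: (i) [7]'s REGION operators (Neumann bonds, r01's corner-based staircase block averages, `a_k = a(L^k)^{−(d+1)}`,
windows `a ∈ [a₋,a₊]`, `0 ≤ m² ≤ m₊²`) fed with `u_k`'s bond variables on regions inside a non-wrapping box; the relation to the whole-torus
`G_k(u_k)` of (4.6.2) and to the tree's centred conventions is NOT addressed; (ii) r01's uniform-`K₀` variants (`…UnifK`) and unit-block
forms are not restated (they transfer verbatim by the same three identities); (iii) `e₁` depends on `(d, ℓ, p, n_Λ, β, c)`, `β < 1`;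
constants `4c₀`, not optimised; `U(1)` as `SO(2)`.  Unit `lit-balaban-p33` (literature-prover-lit-balaban-p33-g12-0), 2026-08-22.  NOT summit
progress.
-/

open scoped BigOperators

namespace Literature.MathematicalPhysics.QuantumFieldTheory.BalabanImbrieJaffe1984to88.BIJ85RegionPropagatorsActualBgMembers

open Balaban1983to89 hiding Site Plaq
open Balaban1983to89.LatticeFieldCalculus
open Balaban1983to89.T4AxialGaugeSmallField (castSite boxBonds)
open BIJ85Sect1Model (U1Field plaq)
open BIJ85Eq454PlaqResidual (actualBg)
open BIJ85SmoothGaugeRegular17 (exists_regular17_gauge_allTori regular17_fineDom_of_box)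
open BIJ85RegionPropagatorsActualBg (fieldLink_compField_eq_bondGauge regionOp_gauge rot_link_of_logField)
open Balaban1983to89.B4GaugeCovariance
open Balaban1983to89.B4Lower18 (fineDom mem_fineDom IsBlockUnion)
open Balaban1983to89.B4Lower18Regular (e1 PathRel rot_lipschitz)
open Balaban1983to89.B4Lower18RegularRegion (compField transport_congr)
open Balaban1983to89.B4Reflection242 (nbrs mem_nbrs blk)
open Balaban1983to89.B4Lemma21Region (regionOp regionDeriv covDeriv dirKer)
open Balaban1983to89.B4Lemma22ReduceZero (covDeriv_gauge)
open Balaban1983to89.B4WalkRouteRegion (rpos)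
open Balaban1983to89.B4RegionCubeCarrier (incl inReg)
open Balaban1983to89.B4ContourShift (supNorm supNorm_nonneg)
open Balaban1983to89.B4Lemma22HolderBox (IsNNChain)
open Balaban1983to89.B4Eq221L2FactorRegion (acBond)
open Balaban1983to89.B4Thm110RegionAllF (thm110_value_region_allF thm110_deriv_region_allF thm19_holder_region_all_allF
  thm112_value_region_allF)
open Balaban1983to89.B4Thm112RegionAllF (thm112_deriv_region_allF thm112_holder_region_all_allF)
open scoped Matrix
open Balaban1983to89 renaming Site → TSite, Plaq → TPlaq

noncomputable section

/-! ## §1  Conjugation algebra for block-diagonal orthogonal gauge operators -/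

section Algebra

variable {X ι : Type*}

/-- a colour component of `𝒢Ψ` at a site is a combination of the components of `Ψ` there with coefficients of modulus `≤ 1`:
`|(𝒢Ψ)(x)_i| ≤ Σ_j |Ψ(x)_j|` — the sup norm is gauge invariant up to the factor `N`. [cite: Balaban1983RegularityDecay, pp.580–581 «the gauge transformation»] -/
theorem abs_blockDiag_mulVec_apply_le [Fintype X] [Fintype ι] [DecidableEq X] [DecidableEq ι] {g : X → Matrix ι ι ℝ}
    (hg : IsGauge g) (Ψ : X × ι → ℝ) (x : X) (i : ι) : |(blockDiag g *ᵥ Ψ) (x, i)| ≤ ∑ j, |Ψ (x, j)| := by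
  have h : (blockDiag g *ᵥ Ψ) (x, i) = ∑ j, g x i j * Ψ (x, j) := by
    have := congrFun (fld_blockDiag_mulVec g Ψ x) i
    simpa [fld, Matrix.mulVec, dotProduct] using this
  rw [h]
  refine (Finset.abs_sum_le_sum_abs _ _).trans (Finset.sum_le_sum fun j _ => ?_)
  rw [abs_mul]
  exact mul_le_of_le_one_left (abs_nonneg _) (abs_apply_le_one_of_orthogonal (hg x) i j)

/-- the same for one block: `|(g(x)w)_i| ≤ Σ_j |w_j|`. [cite: Balaban1983RegularityDecay, pp.580–581 «the gauge transformation»] -/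
theorem abs_gauge_mulVec_le [Fintype ι] [DecidableEq ι] {g : X → Matrix ι ι ℝ} (hg : IsGauge g) (x : X) (w : ι → ℝ)
    (i : ι) : |(g x *ᵥ w) i| ≤ ∑ j, |w j| := by
  simp only [Matrix.mulVec, dotProduct]
  refine (Finset.abs_sum_le_sum_abs _ _).trans (Finset.sum_le_sum fun j _ => ?_)
  rw [abs_mul]
  exact mul_le_of_le_one_left (abs_nonneg _) (abs_apply_le_one_of_orthogonal (hg x) i j)

/-- the entries of `𝒢ᵀf`: `(𝒢ᵀf)(x)_i = Σ_j g(x)_{ji} f(x)_j`. [cite: Balaban1983RegularityDecay, pp.580–581 «the gauge transformation»] -/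
theorem blockDiagT_mulVec_apply [Fintype X] [Fintype ι] [DecidableEq X] (g : X → Matrix ι ι ℝ) (f : X × ι → ℝ) (x : X)
    (i : ι) : ((blockDiag g)ᵀ *ᵥ f) (x, i) = ∑ j, g x j i * f (x, j) := by
  have := congrFun (fld_blockDiag_mulVec (fun x => (g x)ᵀ) f x) i
  rw [← blockDiag_transpose] at this
  simpa [fld, Matrix.mulVec, dotProduct] using this

/-- the sup norm of `𝒢ᵀf` is at most `N` times that of `f`. [cite: Balaban1983RegularityDecay, pp.580–581 «the gauge transformation»] -/
theorem norm_blockDiagT_mulVec_le [Fintype X] [Fintype ι] [DecidableEq X] [DecidableEq ι] {g : X → Matrix ι ι ℝ}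
    (hg : IsGauge g) (f : X × ι → ℝ) : ‖(blockDiag g)ᵀ *ᵥ f‖ ≤ Fintype.card ι * ‖f‖ := by
  refine (pi_norm_le_iff_of_nonneg (by positivity)).mpr fun p => ?_
  obtain ⟨x, i⟩ := p
  rw [Real.norm_eq_abs, blockDiagT_mulVec_apply]
  refine (Finset.abs_sum_le_sum_abs _ _).trans ?_
  calc ∑ j, |g x j i * f (x, j)| ≤ ∑ _j : ι, ‖f‖ := Finset.sum_le_sum fun j _ => by
          rw [abs_mul, ← Real.norm_eq_abs (f (x, j))]
          exact (mul_le_of_le_one_left (norm_nonneg _) (abs_apply_le_one_of_orthogonal (hg x) j i)).trans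
            (norm_le_pi_norm f (x, j))
    _ = Fintype.card ι * ‖f‖ := by rw [Finset.sum_const, nsmul_eq_mul, Finset.card_univ]

/-- **`D′G′f = 𝒢(DG(𝒢ᵀf))`** for `D′ = 𝒢D𝒢ᵀ`, `G′ = 𝒢G𝒢ᵀ`, `𝒢ᵀ𝒢 = 1`. [cite: Balaban1983RegularityDecay, pp.580–581 «the gauge transformation»] -/
theorem conj_deriv_green_mulVec [Fintype X] [Fintype ι] [DecidableEq X] [DecidableEq ι] {g : X → Matrix ι ι ℝ}
    (hg : IsGauge g) (D G : Matrix (X × ι) (X × ι) ℝ) (f : X × ι → ℝ) :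
    (blockDiag g * D * (blockDiag g)ᵀ) *ᵥ ((blockDiag g * G * (blockDiag g)ᵀ) *ᵥ f)
      = blockDiag g *ᵥ (D *ᵥ (G *ᵥ ((blockDiag g)ᵀ *ᵥ f))) := by
  rw [← Matrix.mulVec_mulVec, ← Matrix.mulVec_mulVec, ← Matrix.mulVec_mulVec, ← Matrix.mulVec_mulVec,
    Matrix.mulVec_mulVec (G *ᵥ ((blockDiag g)ᵀ *ᵥ f)) (blockDiag g)ᵀ (blockDiag g), blockDiag_transpose_mul_self hg,
    Matrix.one_mulVec]

/-- **THE HÖLDER DIFFERENCE IS GAUGE COVARIANT**: with `T′ = g(x)·T·g(x′)ᵀ` (the transporter of the gauge-transformed field) and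
`Ψ′ = 𝒢Ψ`, `T′Ψ′(x′) − Ψ′(x) = g(x)·(TΨ(x′) − Ψ(x))`. [cite: Balaban1983RegularityDecay, (1.9) p.573; pp.580–581] -/
theorem holderExpr_conj [Fintype X] [Fintype ι] [DecidableEq X] [DecidableEq ι] {g : X → Matrix ι ι ℝ} (hg : IsGauge g)
    (T : Matrix ι ι ℝ) (Ψ : X × ι → ℝ) (x x' : X) :
    (g x * T * (g x')ᵀ) *ᵥ fld (blockDiag g *ᵥ Ψ) x' - fld (blockDiag g *ᵥ Ψ) x = g x *ᵥ (T *ᵥ fld Ψ x' - fld Ψ x) := by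
  rw [fld_blockDiag_mulVec, fld_blockDiag_mulVec, Matrix.mulVec_sub, ← Matrix.mulVec_mulVec, ← Matrix.mulVec_mulVec,
    Matrix.mulVec_mulVec (fld Ψ x') (g x')ᵀ (g x'), hg x', Matrix.one_mulVec]

end Algebra

/-! ## §2  Gauge covariance of the covariant derivative and of the transporters on a region, in component form -/

section Region

-- `ι : Type` (not `Type*`): r01's `B4Lemma22ReduceZero.covDeriv_gauge` is stated in universe `0`.
variable {ι : Type} {d : ℕ}

/-- the direction-`μ` covariant derivative reads the link variables only on the bonds `⟨x, x + e_μ⟩`.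
[cite: Balaban1983RegularityDecay, (1.3) p.572] -/
theorem covDeriv_congr_dir [Fintype ι] [DecidableEq ι] {n : ℕ} {R : Finset (Fin (d + 1) → ℤ)}
    {W W' : ↥R → ↥R → Matrix ι ι ℝ} {μ : Fin (d + 1)} (h : ∀ x z : ↥R, z.1 = x.1 + e1 μ → W x z = W' x z) :
    covDeriv n R W μ = covDeriv n R W' μ := by
  unfold covDeriv
  congr 1
  funext x z
  unfold dirKer
  by_cases hz : z.1 = x.1 + e1 μ
  · rw [h x z hz]
  · simp only [hz, if_false]

/-- **GAUGE COVARIANCE OF [7]'s COVARIANT DERIVATIVE `D^η_{A,μ}` (1.3) ON A REGION, IN COMPONENT FORM**: if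
`U(κA′_ν(x)) = U(κ(A_ν(x) + σ(x) − σ(x + e_ν)))` whenever `x, x + e_ν ∈ Ω` (`κ = e/n`), then
`D^η_{A′,μ} = 𝒢_σ D^η_{A,μ} 𝒢_σᵀ` with `𝒢_σ = ⊕_x U(κσ(x))` (r01's `covDeriv_gauge` at the gauged link variables).
[cite: Balaban1983RegularityDecay, (1.3) p.572; pp.580–581 «the gauge transformation»] -/
theorem regionDeriv_gauge [Fintype ι] [DecidableEq ι] (F : OrthFlow ι) (e₀ : ℝ) (n : ℕ) (Ωc : Finset (Fin (d + 1) → ℤ))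
    {Ac Ac' : (Fin (d + 1) → ℤ) → Fin (d + 1) → ℝ} {σ : (Fin (d + 1) → ℤ) → ℝ}
    (hlink : ∀ x ∈ fineDom n Ωc, ∀ ν : Fin (d + 1), x + e1 ν ∈ fineDom n Ωc →
      F.U (e₀ / n * Ac' x ν) = F.U (e₀ / n * (Ac x ν + σ x - σ (x + e1 ν)))) (μ : Fin (d + 1)) :
    regionDeriv F e₀ n Ωc Ac' μ
      = blockDiag (fun u : ↥(fineDom n Ωc) => F.U (e₀ / n * σ u.1)) * regionDeriv F e₀ n Ωc Ac μ
          * (blockDiag fun u : ↥(fineDom n Ωc) => F.U (e₀ / n * σ u.1))ᵀ := by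
  unfold regionDeriv
  rw [covDeriv_congr_dir (W' := gaugeKer (fun u : ↥(fineDom n Ωc) => F.U (e₀ / n * σ u.1))
      (fun u : ↥(fineDom n Ωc) => F.U (e₀ / n * σ u.1)) (fieldLink F (e₀ / n) fun u v : ↥(fineDom n Ωc) => compField Ac u.1 v.1))
      (fun x z hz => by
        rw [fieldLink_compField_eq_bondGauge F (e₀ / n) hlink x z (mem_nbrs.mpr ⟨μ, Or.inl hz⟩), fieldLink_bondGauge]),
    covDeriv_gauge (F.isGauge _)]

/-- nearest-neighbour chains are contours with nearest-neighbour steps. [folklore] -/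
private theorem pathRel_of_isNNChain {R : Finset (Fin (d + 1) → ℤ)} :
    ∀ (x : ↥R) (l : List ↥R), IsNNChain x l → PathRel (fun u v : ↥R => v.1 ∈ nbrs u.1) x l
  | _, [], _ => trivial
  | _, y :: l, h => ⟨h.1, pathRel_of_isNNChain y l h.2⟩

/-- **GAUGE COVARIANCE OF THE PARALLEL TRANSPORTERS `U(A(Γ))` ALONG A NEAREST-NEIGHBOUR CONTOUR IN THE REGION**: under the same bond-local link
relation, `U(A′(Γ_{x→x_end})) = U(κσ(x))·U(A(Γ))·U(κσ(x_end))ᵀ` (telescoping, r01's `transport_gauge`).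
[cite: Balaban1983RegularityDecay, (1.4) p.572, (1.9) p.573; pp.580–581] -/
theorem transport_acBond_gauge [Fintype ι] [DecidableEq ι] (F : OrthFlow ι) (e₀ : ℝ) (n : ℕ) (Ωc : Finset (Fin (d + 1) → ℤ))
    {Ac Ac' : (Fin (d + 1) → ℤ) → Fin (d + 1) → ℝ} {σ : (Fin (d + 1) → ℤ) → ℝ}
    (hlink : ∀ x ∈ fineDom n Ωc, ∀ ν : Fin (d + 1), x + e1 ν ∈ fineDom n Ωc →
      F.U (e₀ / n * Ac' x ν) = F.U (e₀ / n * (Ac x ν + σ x - σ (x + e1 ν))))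
    (x : ↥(fineDom n Ωc)) (l : List ↥(fineDom n Ωc)) (hl : IsNNChain x l) :
    transport (fieldLink F (e₀ / n) (acBond Ωc Ac')) x l
      = F.U (e₀ / n * σ x.1) * transport (fieldLink F (e₀ / n) (acBond Ωc Ac)) x l * (F.U (e₀ / n * σ (pathEnd x l).1))ᵀ := by
  have h1 : transport (fieldLink F (e₀ / n) (acBond Ωc Ac')) x l
      = transport (gaugeKer (fun u : ↥(fineDom n Ωc) => F.U (e₀ / n * σ u.1)) (fun u : ↥(fineDom n Ωc) => F.U (e₀ / n * σ u.1))
          (fieldLink F (e₀ / n) (acBond Ωc Ac))) x l :=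
    transport_congr (r := fun u v : ↥(fineDom n Ωc) => v.1 ∈ nbrs u.1)
      (fun u v huv => by
        show fieldLink F (e₀ / n) (fun u v : ↥(fineDom n Ωc) => compField Ac' u.1 v.1) u v = _
        rw [fieldLink_compField_eq_bondGauge F (e₀ / n) hlink u v huv, fieldLink_bondGauge])
      x l (pathRel_of_isNNChain x l hl)
  rw [h1, transport_gauge (F.isGauge _)]

end Region

/-! ## §3  The actual background on the tori `P.L = ℓ + 1`: the smooth gauge, its regularity, and the link relation for every logarithm field -/

section Actual

variable {P : Params} {d : ℕ}

/-- **FILES 1–3 REPACKAGED FOR r01's `(ℓ + 1)^k` SHAPES**: for every `d ≥ 1`, `ℓ ≥ 1` with `ℓ + 1` odd, `p`, box size `n`, `β < 1`, `c > 0`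
there is `e₁ > 0` such that on every torus (`P.d = d + 1`, `P.L = ℓ + 1`), every scale `1 ≤ k ≤ m + K`, every `0 < e ≤ e₁`, every unit field `v`
with (7.3.1), every non-wrapping box and every finite set `Ω` of unit labels whose blocks sit in the box with one bond of slack, there are `λ`, `A`
with: the charted `A_ν(x) := A(⟨x, ν⟩)` is regular (1.7) on `Ω` (`|A_ν(x + e_μ) − A_ν(x)| ≤ c·e^{β−1}/(ℓ+1)^k`), AND for EVERY logarithm field
`A′` of `u_k` on `Ω` the link variables of `A′` are those of the gauge transform of `A` by `σ = −(ℓ+1)^k·λ`.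
[cite: BalabanImbrieJaffe1985, §7.3 p.326; Balaban1983RegularityDecay, (1.7) p.572] -/
theorem exists_smooth_gauge_links {d ℓ : ℕ} (hd : 1 ≤ d) (hℓ : 1 ≤ ℓ) (hodd : Odd (ℓ + 1)) (pexp : ℝ) (n : ℕ) {β c : ℝ}
    (hβ : β < 1) (hc : 0 < c) :
    ∃ e₁ : ℝ, 0 < e₁ ∧ ∀ (P : Params) (hPd : P.d = d + 1), P.L = ℓ + 1 → ∀ (k : ℕ), 1 ≤ k → ∀ (hk : k ≤ P.m + P.K)
      (e₀ : ℝ), 0 < e₀ → e₀ ≤ e₁ →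
      ∀ (v : U1Field P k), (∀ p : TPlaq P k, ‖((plaq v p : Circle) : ℂ) - 1‖ ≤ e₀ * (1 + Real.log e₀⁻¹) ^ pexp) →
      ∀ (lo hi : Fin P.d → ℤ), (∀ κ, hi κ ≤ lo κ + n) → n < P.sitesPerDir 0 →
      ∀ (Ωc : Finset (Fin (d + 1) → ℤ)), (∀ y ∈ Ωc, ∀ i : Fin (d + 1),
        lo (Fin.cast hPd.symm i) ≤ (P.L : ℤ) ^ k * y i ∧ (P.L : ℤ) ^ k * y i + (P.L : ℤ) ^ k ≤ hi (Fin.cast hPd.symm i)) →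
      ∃ (lam : TSite P 0 → ℝ) (A : PBond P 0 → ℝ),
        (∀ x ∈ fineDom ((ℓ + 1) ^ k) Ωc, ∀ μ ν : Fin (d + 1),
          |A ⟨castSite (fun j : Fin P.d => (x + e1 μ) (Fin.cast hPd j)), Fin.cast hPd.symm ν⟩ -
              A ⟨castSite (fun j : Fin P.d => x (Fin.cast hPd j)), Fin.cast hPd.symm ν⟩| ≤
            c * e₀ ^ (β - 1) / (((ℓ + 1) ^ k : ℕ) : ℝ)) ∧
        ∀ (Ac' : (Fin (d + 1) → ℤ) → Fin (d + 1) → ℝ),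
          (∀ x ∈ fineDom ((ℓ + 1) ^ k) Ωc, ∀ ν : Fin (d + 1), x + e1 ν ∈ fineDom ((ℓ + 1) ^ k) Ωc →
            Circle.exp (e₀ / (((ℓ + 1) ^ k : ℕ) : ℝ) * Ac' x ν) =
              actualBg ((Nat.succ_le_succ hd).trans_eq hPd.symm) k e₀ v
                ⟨castSite (fun j : Fin P.d => x (Fin.cast hPd j)), Fin.cast hPd.symm ν⟩) →
          ∀ x ∈ fineDom ((ℓ + 1) ^ k) Ωc, ∀ ν : Fin (d + 1), x + e1 ν ∈ fineDom ((ℓ + 1) ^ k) Ωc →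
            OrthFlow.rot.U (e₀ / (((ℓ + 1) ^ k : ℕ) : ℝ) * Ac' x ν)
              = OrthFlow.rot.U (e₀ / (((ℓ + 1) ^ k : ℕ) : ℝ) *
                  (A ⟨castSite (fun j : Fin P.d => x (Fin.cast hPd j)), Fin.cast hPd.symm ν⟩
                    + -((((ℓ + 1) ^ k : ℕ) : ℝ) * lam (castSite (fun j : Fin P.d => x (Fin.cast hPd j))))
                    - -((((ℓ + 1) ^ k : ℕ) : ℝ) * lam (castSite (fun j : Fin P.d => (x + e1 ν) (Fin.cast hPd j)))))) := by
  have hL : Odd (ℓ + 1) ∧ 1 < ℓ + 1 := ⟨hodd, by omega⟩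
  obtain ⟨e₁, he₁, hall⟩ := exists_regular17_gauge_allTori (Nat.succ_le_succ hd) hL pexp n hβ hc
  refine ⟨e₁, he₁, fun P hPd hPL k hk1 hk e₀ he hle v hv lo hi hbox hnN Ωc hΩ => ?_⟩
  obtain ⟨lam, A, hform, -, hgradA⟩ := hall P hPd hPL k hk1 hk e₀ he hle v hv lo hi hbox hnN
  have hPLk : P.L ^ k = (ℓ + 1) ^ k := by rw [hPL]
  have hreg := regular17_fineDom_of_box hPd hgradA Ωc hΩ
  rw [hPLk] at hreg
  refine ⟨lam, A, hreg, fun Ac' hlog => ?_⟩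
  have hlog' := hlog
  rw [← hPLk] at hlog'
  have hlink := rot_link_of_logField hPd hΩ hform hlog'
  rw [hPLk] at hlink
  exact hlink

end Actual

/-! ## §4  (1.10), value and derivative members, arbitrary source, for `G_k(Ω, u_k)` -/

section Thm110

variable {d : ℕ}

/-- **THEOREM (1.10), VALUE member, FOR [7]'s GREEN'S FUNCTION AT THE ACTUAL BACKGROUND ON A LOCAL REGION, ARBITRARY SOURCE** — r01's
`B4Thm110RegionAllF.thm110_value_region_allF` (general `Ω` = union of `K₀`-blocks under the `R₀` restriction at `x`; every `f` vanishing
off a set of sites at `ℓ^∞`-distance `≥ D` from `x`; windows `a ∈ [a₋,a₊]`, `0 ≤ m² ≤ m₊²`) TRANSFERRED to `G_k(Ω, u_k) = (regionOp rot e Ω A′)⁻¹`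
at EVERY logarithm field `A′` of `u_k` on `Ω` (file 4: the operator does not depend on `A′`), on every torus (`P.d = d + 1`, `P.L = ℓ + 1`),
every scale, under (7.3.1) with `0 < e ≤ e₁`, for regions inside a non-wrapping box:
`|(G_k(Ω, u_k)f)(x)_i| ≤ c₀·exp(−D/(2(ℓ+1)^kK₀))·‖f‖_∞`. [cite: BalabanImbrieJaffe1985, §7.3 p.326; Balaban1983RegularityDecay, Theorem (1.10) p.573] -/
theorem thm110_value_region_actualBg_allF {d ℓ : ℕ} (hd : 1 ≤ d) (hℓ : 1 ≤ ℓ) (hodd : Odd (ℓ + 1)) (pexp : ℝ) (n : ℕ)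
    (amin aplus m2plus : ℝ) (ha : 0 < amin) :
    ∃ K₀ : ℕ, 8 ≤ K₀ ∧ 8 ∣ K₀ ∧ ∃ c₀ : ℝ, 0 < c₀ ∧ ∀ (c β : ℝ), 0 < c → 0 < β → β < 1 →
      ∃ e₁ : ℝ, 0 < e₁ ∧ ∀ (P : Params) (hPd : P.d = d + 1), P.L = ℓ + 1 → ∀ (k : ℕ), 1 ≤ k → ∀ (hk : k ≤ P.m + P.K)
      (e₀ : ℝ), 0 < e₀ → e₀ ≤ e₁ →
      ∀ (v : U1Field P k), (∀ p : TPlaq P k, ‖((plaq v p : Circle) : ℂ) - 1‖ ≤ e₀ * (1 + Real.log e₀⁻¹) ^ pexp) →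
      ∀ (lo hi : Fin P.d → ℤ), (∀ κ, hi κ ≤ lo κ + n) → n < P.sitesPerDir 0 →
      ∀ (Ωc : Finset (Fin (d + 1) → ℤ)), IsBlockUnion K₀ Ωc → (∀ y ∈ Ωc, ∀ i : Fin (d + 1),
        lo (Fin.cast hPd.symm i) ≤ (P.L : ℤ) ^ k * y i ∧ (P.L : ℤ) ^ k * y i + (P.L : ℤ) ^ k ≤ hi (Fin.cast hPd.symm i)) →
      ∀ (Ac' : (Fin (d + 1) → ℤ) → Fin (d + 1) → ℝ),
        (∀ x ∈ fineDom ((ℓ + 1) ^ k) Ωc, ∀ ν : Fin (d + 1), x + e1 ν ∈ fineDom ((ℓ + 1) ^ k) Ωc →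
          Circle.exp (e₀ / (((ℓ + 1) ^ k : ℕ) : ℝ) * Ac' x ν) =
            actualBg ((Nat.succ_le_succ hd).trans_eq hPd.symm) k e₀ v
              ⟨castSite (fun j : Fin P.d => x (Fin.cast hPd j)), Fin.cast hPd.symm ν⟩) →
        ∀ (hn : 1 ≤ (ℓ + 1) ^ k) (a m2 : ℝ), amin ≤ a → a ≤ aplus → 0 ≤ m2 → m2 ≤ m2plus →
        ∀ (x : ↥(fineDom ((ℓ + 1) ^ k) Ωc)),
          (∀ y : Fin (d + 1) → ℤ, (∀ μ, |y μ - blk ((ℓ + 1) ^ k) x.1 μ| ≤ (K₀ : ℤ) * (d + 3)) → y ∈ Ωc) →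
        ∀ (S : ↥(fineDom ((ℓ + 1) ^ k) Ωc) → Prop) (D : ℝ),
          (∀ x', S x' → ∃ μ, D ≤ |rpos ((ℓ + 1) ^ k) Ωc x μ - rpos ((ℓ + 1) ^ k) Ωc x' μ|) →
        ∀ (f : ↥(fineDom ((ℓ + 1) ^ k) Ωc) × Fin 2 → ℝ), (∀ p, ¬ S p.1 → f p = 0) →
        ∀ i : Fin 2,
          |((regionOp OrthFlow.rot e₀ hn (B1.aSeq a ((ℓ : ℝ) + 1) k) m2 Ωc Ac')⁻¹ *ᵥ f) (x, i)|
            ≤ c₀ * Real.exp (-(D / (2 * ((((ℓ + 1) ^ k : ℕ) : ℝ) * K₀)))) * ‖f‖ := by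
  obtain ⟨K₀, hK8, h8, c₀, hc₀, H⟩ := thm110_value_region_allF OrthFlow.rot zero_le_one rot_lipschitz d ℓ hℓ amin aplus m2plus ha
  refine ⟨K₀, hK8, h8, 4 * c₀, by positivity, fun c β hc hβ0 hβ1 => ?_⟩
  obtain ⟨e₁', he₁', H'⟩ := H c β hc.le hβ0
  obtain ⟨e₁, he₁, hall⟩ := exists_smooth_gauge_links hd hℓ hodd pexp n hβ1 hc
  refine ⟨min e₁ e₁', lt_min he₁ he₁', fun P hPd hPL k hk1 hk e₀ he hle v hv lo hi hbox hnN Ωc hBU hΩ Ac' hlog hn a m2 ha1 ha2 hm1 hm2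
    x hR S D hD f hf i => ?_⟩
  obtain ⟨lam, A, hreg, hlinks⟩ := hall P hPd hPL k hk1 hk e₀ he (hle.trans (min_le_left _ _)) v hv lo hi hbox hnN Ωc hΩ
  have hlink := hlinks Ac' hlog
  obtain ⟨g, hg_def⟩ : ∃ g : ↥(fineDom ((ℓ + 1) ^ k) Ωc) → Matrix (Fin 2) (Fin 2) ℝ, g = fun u => OrthFlow.rot.U
      (e₀ / (((ℓ + 1) ^ k : ℕ) : ℝ) * -((((ℓ + 1) ^ k : ℕ) : ℝ) * lam (castSite (fun j : Fin P.d => u.1 (Fin.cast hPd j))))) :=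
    ⟨_, rfl⟩
  have hg : IsGauge g := by rw [hg_def]; exact OrthFlow.rot.isGauge _
  have hop : regionOp OrthFlow.rot e₀ hn (B1.aSeq a ((ℓ : ℝ) + 1) k) m2 Ωc Ac'
      = blockDiag g * regionOp OrthFlow.rot e₀ hn (B1.aSeq a ((ℓ : ℝ) + 1) k) m2 Ωc
          (fun x ν => A ⟨castSite (fun j : Fin P.d => x (Fin.cast hPd j)), Fin.cast hPd.symm ν⟩) * (blockDiag g)ᵀ := by
    rw [hg_def]
    exact regionOp_gauge OrthFlow.rot e₀ hn (B1.aSeq a ((ℓ : ℝ) + 1) k) m2 Ωc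
      (Ac := fun x ν => A ⟨castSite (fun j : Fin P.d => x (Fin.cast hPd j)), Fin.cast hPd.symm ν⟩)
      (σ := fun x => -((((ℓ + 1) ^ k : ℕ) : ℝ) * lam (castSite (fun j : Fin P.d => x (Fin.cast hPd j))))) hlink
  -- the transformed source `𝒢ᵀf` has the same support
  have hfT : ∀ p : ↥(fineDom ((ℓ + 1) ^ k) Ωc) × Fin 2, ¬ S p.1 → ((blockDiag g)ᵀ *ᵥ f) p = 0 := by
    rintro ⟨y, j⟩ hy
    rw [blockDiagT_mulVec_apply]
    exact Finset.sum_eq_zero fun j' _ => by rw [hf (y, j') hy, mul_zero]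
  rw [hop, conj_inv hg, ← Matrix.mulVec_mulVec, ← Matrix.mulVec_mulVec]
  refine (abs_blockDiag_mulVec_apply_le hg _ x i).trans ?_
  have hE : 0 ≤ c₀ * Real.exp (-(D / (2 * ((((ℓ + 1) ^ k : ℕ) : ℝ) * K₀)))) := by positivity
  have hnT := norm_blockDiagT_mulVec_le hg f
  simp only [Fintype.card_fin, Nat.cast_ofNat] at hnT
  calc ∑ j : Fin 2, |((regionOp OrthFlow.rot e₀ hn (B1.aSeq a ((ℓ : ℝ) + 1) k) m2 Ωc
            (fun x ν => A ⟨castSite (fun j : Fin P.d => x (Fin.cast hPd j)), Fin.cast hPd.symm ν⟩))⁻¹ *ᵥ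
              ((blockDiag g)ᵀ *ᵥ f)) (x, j)|
      ≤ ∑ _j : Fin 2, c₀ * Real.exp (-(D / (2 * ((((ℓ + 1) ^ k : ℕ) : ℝ) * K₀)))) * (2 * ‖f‖) :=
        Finset.sum_le_sum fun j _ =>
          (H' k hk1 hn a m2 ha1 ha2 hm1 hm2 Ωc hBU _ e₀ he (hle.trans (min_le_right _ _)) hreg x hR S D hD _ hfT j).trans
            (mul_le_mul_of_nonneg_left hnT hE)
    _ = 4 * c₀ * Real.exp (-(D / (2 * ((((ℓ + 1) ^ k : ℕ) : ℝ) * K₀)))) * ‖f‖ := by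
        simp only [Finset.sum_const, Finset.card_univ, Fintype.card_fin, nsmul_eq_mul, Nat.cast_ofNat]
        ring

/-- **THEOREM (1.10), DERIVATIVE member, FOR `G_k(Ω, u_k)`, ARBITRARY SOURCE** — r01's `B4Thm110RegionAllF.thm110_deriv_region_allF`
transferred: for the covariant derivative `D^η_{u_k,μ}` built from `u_k`'s bond variables (`regionDeriv rot e Ω A′ μ` at any logarithm field
`A′` — gauge covariant by §2) and `x` with `x + e_μ ∈ Ω` under the `R₀` radius `K₀(d + 3) + 1`:
`|(D^η_{u_k,μ} G_k(Ω, u_k) f)(x)_i| ≤ c₀·exp(−D/(2(ℓ+1)^kK₀))·‖f‖_∞`. [cite: BalabanImbrieJaffe1985, §7.3 p.326; Balaban1983RegularityDecay, Theorem (1.10) p.573] -/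
theorem thm110_deriv_region_actualBg_allF {d ℓ : ℕ} (hd : 1 ≤ d) (hℓ : 1 ≤ ℓ) (hodd : Odd (ℓ + 1)) (pexp : ℝ) (n : ℕ)
    (amin aplus m2plus : ℝ) (ha : 0 < amin) :
    ∃ K₀ : ℕ, 8 ≤ K₀ ∧ 8 ∣ K₀ ∧ ∃ c₀ : ℝ, 0 < c₀ ∧ ∀ (c β : ℝ), 0 < c → 0 < β → β < 1 →
      ∃ e₁ : ℝ, 0 < e₁ ∧ ∀ (P : Params) (hPd : P.d = d + 1), P.L = ℓ + 1 → ∀ (k : ℕ), 1 ≤ k → ∀ (hk : k ≤ P.m + P.K)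
      (e₀ : ℝ), 0 < e₀ → e₀ ≤ e₁ →
      ∀ (v : U1Field P k), (∀ p : TPlaq P k, ‖((plaq v p : Circle) : ℂ) - 1‖ ≤ e₀ * (1 + Real.log e₀⁻¹) ^ pexp) →
      ∀ (lo hi : Fin P.d → ℤ), (∀ κ, hi κ ≤ lo κ + n) → n < P.sitesPerDir 0 →
      ∀ (Ωc : Finset (Fin (d + 1) → ℤ)), IsBlockUnion K₀ Ωc → (∀ y ∈ Ωc, ∀ i : Fin (d + 1),
        lo (Fin.cast hPd.symm i) ≤ (P.L : ℤ) ^ k * y i ∧ (P.L : ℤ) ^ k * y i + (P.L : ℤ) ^ k ≤ hi (Fin.cast hPd.symm i)) →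
      ∀ (Ac' : (Fin (d + 1) → ℤ) → Fin (d + 1) → ℝ),
        (∀ x ∈ fineDom ((ℓ + 1) ^ k) Ωc, ∀ ν : Fin (d + 1), x + e1 ν ∈ fineDom ((ℓ + 1) ^ k) Ωc →
          Circle.exp (e₀ / (((ℓ + 1) ^ k : ℕ) : ℝ) * Ac' x ν) =
            actualBg ((Nat.succ_le_succ hd).trans_eq hPd.symm) k e₀ v
              ⟨castSite (fun j : Fin P.d => x (Fin.cast hPd j)), Fin.cast hPd.symm ν⟩) →
        ∀ (hn : 1 ≤ (ℓ + 1) ^ k) (a m2 : ℝ), amin ≤ a → a ≤ aplus → 0 ≤ m2 → m2 ≤ m2plus →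
        ∀ (μ : Fin (d + 1)) (x : ↥(fineDom ((ℓ + 1) ^ k) Ωc)), x.1 + e1 μ ∈ fineDom ((ℓ + 1) ^ k) Ωc →
          (∀ y : Fin (d + 1) → ℤ, (∀ ν, |y ν - blk ((ℓ + 1) ^ k) x.1 ν| ≤ (K₀ : ℤ) * (d + 3) + 1) → y ∈ Ωc) →
        ∀ (S : ↥(fineDom ((ℓ + 1) ^ k) Ωc) → Prop) (D : ℝ),
          (∀ x', S x' → ∃ ν, D ≤ |rpos ((ℓ + 1) ^ k) Ωc x ν - rpos ((ℓ + 1) ^ k) Ωc x' ν|) →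
        ∀ (f : ↥(fineDom ((ℓ + 1) ^ k) Ωc) × Fin 2 → ℝ), (∀ p, ¬ S p.1 → f p = 0) →
        ∀ i : Fin 2,
          |(regionDeriv OrthFlow.rot e₀ ((ℓ + 1) ^ k) Ωc Ac' μ
              *ᵥ ((regionOp OrthFlow.rot e₀ hn (B1.aSeq a ((ℓ : ℝ) + 1) k) m2 Ωc Ac')⁻¹ *ᵥ f)) (x, i)|
            ≤ c₀ * Real.exp (-(D / (2 * ((((ℓ + 1) ^ k : ℕ) : ℝ) * K₀)))) * ‖f‖ := by
  obtain ⟨K₀, hK8, h8, c₀, hc₀, H⟩ := thm110_deriv_region_allF OrthFlow.rot zero_le_one rot_lipschitz d ℓ hℓ amin aplus m2plus ha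
  refine ⟨K₀, hK8, h8, 4 * c₀, by positivity, fun c β hc hβ0 hβ1 => ?_⟩
  obtain ⟨e₁', he₁', H'⟩ := H c β hc.le hβ0
  obtain ⟨e₁, he₁, hall⟩ := exists_smooth_gauge_links hd hℓ hodd pexp n hβ1 hc
  refine ⟨min e₁ e₁', lt_min he₁ he₁', fun P hPd hPL k hk1 hk e₀ he hle v hv lo hi hbox hnN Ωc hBU hΩ Ac' hlog hn a m2 ha1 ha2 hm1 hm2
    μ x hxμ hR S D hD f hf i => ?_⟩
  obtain ⟨lam, A, hreg, hlinks⟩ := hall P hPd hPL k hk1 hk e₀ he (hle.trans (min_le_left _ _)) v hv lo hi hbox hnN Ωc hΩ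
  have hlink := hlinks Ac' hlog
  obtain ⟨g, hg_def⟩ : ∃ g : ↥(fineDom ((ℓ + 1) ^ k) Ωc) → Matrix (Fin 2) (Fin 2) ℝ, g = fun u => OrthFlow.rot.U
      (e₀ / (((ℓ + 1) ^ k : ℕ) : ℝ) * -((((ℓ + 1) ^ k : ℕ) : ℝ) * lam (castSite (fun j : Fin P.d => u.1 (Fin.cast hPd j))))) :=
    ⟨_, rfl⟩
  have hg : IsGauge g := by rw [hg_def]; exact OrthFlow.rot.isGauge _
  have hop : regionOp OrthFlow.rot e₀ hn (B1.aSeq a ((ℓ : ℝ) + 1) k) m2 Ωc Ac'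
      = blockDiag g * regionOp OrthFlow.rot e₀ hn (B1.aSeq a ((ℓ : ℝ) + 1) k) m2 Ωc
          (fun x ν => A ⟨castSite (fun j : Fin P.d => x (Fin.cast hPd j)), Fin.cast hPd.symm ν⟩) * (blockDiag g)ᵀ := by
    rw [hg_def]
    exact regionOp_gauge OrthFlow.rot e₀ hn (B1.aSeq a ((ℓ : ℝ) + 1) k) m2 Ωc
      (Ac := fun x ν => A ⟨castSite (fun j : Fin P.d => x (Fin.cast hPd j)), Fin.cast hPd.symm ν⟩)
      (σ := fun x => -((((ℓ + 1) ^ k : ℕ) : ℝ) * lam (castSite (fun j : Fin P.d => x (Fin.cast hPd j))))) hlink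
  have hDer : regionDeriv OrthFlow.rot e₀ ((ℓ + 1) ^ k) Ωc Ac' μ
      = blockDiag g * regionDeriv OrthFlow.rot e₀ ((ℓ + 1) ^ k) Ωc
          (fun x ν => A ⟨castSite (fun j : Fin P.d => x (Fin.cast hPd j)), Fin.cast hPd.symm ν⟩) μ * (blockDiag g)ᵀ := by
    rw [hg_def]
    exact regionDeriv_gauge OrthFlow.rot e₀ ((ℓ + 1) ^ k) Ωc
      (Ac := fun x ν => A ⟨castSite (fun j : Fin P.d => x (Fin.cast hPd j)), Fin.cast hPd.symm ν⟩)
      (σ := fun x => -((((ℓ + 1) ^ k : ℕ) : ℝ) * lam (castSite (fun j : Fin P.d => x (Fin.cast hPd j))))) hlink μ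
  have hfT : ∀ p : ↥(fineDom ((ℓ + 1) ^ k) Ωc) × Fin 2, ¬ S p.1 → ((blockDiag g)ᵀ *ᵥ f) p = 0 := by
    rintro ⟨y, j⟩ hy
    rw [blockDiagT_mulVec_apply]
    exact Finset.sum_eq_zero fun j' _ => by rw [hf (y, j') hy, mul_zero]
  rw [hop, hDer, conj_inv hg, conj_deriv_green_mulVec hg]
  refine (abs_blockDiag_mulVec_apply_le hg _ x i).trans ?_
  have hE : 0 ≤ c₀ * Real.exp (-(D / (2 * ((((ℓ + 1) ^ k : ℕ) : ℝ) * K₀)))) := by positivity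
  have hnT := norm_blockDiagT_mulVec_le hg f
  simp only [Fintype.card_fin, Nat.cast_ofNat] at hnT
  calc ∑ j : Fin 2, |(regionDeriv OrthFlow.rot e₀ ((ℓ + 1) ^ k) Ωc
            (fun x ν => A ⟨castSite (fun j : Fin P.d => x (Fin.cast hPd j)), Fin.cast hPd.symm ν⟩) μ *ᵥ
            ((regionOp OrthFlow.rot e₀ hn (B1.aSeq a ((ℓ : ℝ) + 1) k) m2 Ωc
              (fun x ν => A ⟨castSite (fun j : Fin P.d => x (Fin.cast hPd j)), Fin.cast hPd.symm ν⟩))⁻¹ *ᵥ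
                ((blockDiag g)ᵀ *ᵥ f))) (x, j)|
      ≤ ∑ _j : Fin 2, c₀ * Real.exp (-(D / (2 * ((((ℓ + 1) ^ k : ℕ) : ℝ) * K₀)))) * (2 * ‖f‖) :=
        Finset.sum_le_sum fun j _ =>
          (H' k hk1 hn a m2 ha1 ha2 hm1 hm2 Ωc hBU _ e₀ he (hle.trans (min_le_right _ _)) hreg μ x hxμ hR S D hD _ hfT j).trans
            (mul_le_mul_of_nonneg_left hnT hE)
    _ = 4 * c₀ * Real.exp (-(D / (2 * ((((ℓ + 1) ^ k : ℕ) : ℝ) * K₀)))) * ‖f‖ := by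
        simp only [Finset.sum_const, Finset.card_univ, Fintype.card_fin, nsmul_eq_mul, Nat.cast_ofNat]
        ring

end Thm110

/-! ## §5  (1.9), the Hölder member (regularity), arbitrary source, for `G_k(Ω, u_k)` -/

section Thm19

variable {d : ℕ}

/-- **THEOREM (1.9), THE HÖLDER MEMBER — THE «REGULARITY» ESTIMATE OF [7] — FOR `G_k(Ω, u_k)` AT THE ACTUAL BACKGROUND ON A LOCAL REGION,
ALL PAIRS, ARBITRARY SOURCE**: r01's `B4Thm110RegionAllF.thm19_holder_region_all_allF` (`0 ≤ α < 1`; `K₀ ≥ 16`, `8 ∣ K₀`; pairs `x ≠ x′`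
with both `μ`-bonds in `Ω`; a nearest-neighbour contour `Γ` from `x` to `x′` of length `≤ (d+1)|x′−x|_∞` inside the sup-ball; `R₀` radius
`K₀(d + 4)` at both points; every `f` vanishing off a set at `ℓ^∞`-distance `≥ D` from both points) TRANSFERRED to the propagator and the
covariant derivative built from `u_k`'s bond variables, WITH THE TRANSPORTER `U(u_k(Γ))` of the same field (`transport (fieldLink rot (e/n)
(acBond Ω A′)) x Γ`, any logarithm field `A′`; gauge covariant by §2):
`((ℓ+1)^k/|x′−x|_∞)^α · |U(u_k(Γ))(D^η_{u_k,μ}G_k(Ω,u_k)f)(x′) − (D^η_{u_k,μ}G_k(Ω,u_k)f)(x)|_i ≤ c₀·exp(−D/(2(ℓ+1)^kK₀))·‖f‖_∞`.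
[cite: BalabanImbrieJaffe1985, §7.3 p.326 «regularity … estimates of [7]»; Balaban1983RegularityDecay, Theorem (1.9) p.573] -/
theorem thm19_holder_region_actualBg_allF {d ℓ : ℕ} (hd : 1 ≤ d) (hℓ : 1 ≤ ℓ) (hodd : Odd (ℓ + 1)) (pexp : ℝ) (n : ℕ)
    (amin aplus m2plus : ℝ) (ha : 0 < amin) (α : ℝ) (hα0 : 0 ≤ α) (hα1 : α < 1) :
    ∃ K₀ : ℕ, 16 ≤ K₀ ∧ 8 ∣ K₀ ∧ ∃ c₀ : ℝ, 0 < c₀ ∧ ∀ (c β : ℝ), 0 < c → 0 < β → β < 1 →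
      ∃ e₁ : ℝ, 0 < e₁ ∧ ∀ (P : Params) (hPd : P.d = d + 1), P.L = ℓ + 1 → ∀ (k : ℕ), 1 ≤ k → ∀ (hk : k ≤ P.m + P.K)
      (e₀ : ℝ), 0 < e₀ → e₀ ≤ e₁ →
      ∀ (v : U1Field P k), (∀ p : TPlaq P k, ‖((plaq v p : Circle) : ℂ) - 1‖ ≤ e₀ * (1 + Real.log e₀⁻¹) ^ pexp) →
      ∀ (lo hi : Fin P.d → ℤ), (∀ κ, hi κ ≤ lo κ + n) → n < P.sitesPerDir 0 →
      ∀ (Ωc : Finset (Fin (d + 1) → ℤ)), IsBlockUnion K₀ Ωc → (∀ y ∈ Ωc, ∀ i : Fin (d + 1),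
        lo (Fin.cast hPd.symm i) ≤ (P.L : ℤ) ^ k * y i ∧ (P.L : ℤ) ^ k * y i + (P.L : ℤ) ^ k ≤ hi (Fin.cast hPd.symm i)) →
      ∀ (Ac' : (Fin (d + 1) → ℤ) → Fin (d + 1) → ℝ),
        (∀ x ∈ fineDom ((ℓ + 1) ^ k) Ωc, ∀ ν : Fin (d + 1), x + e1 ν ∈ fineDom ((ℓ + 1) ^ k) Ωc →
          Circle.exp (e₀ / (((ℓ + 1) ^ k : ℕ) : ℝ) * Ac' x ν) =
            actualBg ((Nat.succ_le_succ hd).trans_eq hPd.symm) k e₀ v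
              ⟨castSite (fun j : Fin P.d => x (Fin.cast hPd j)), Fin.cast hPd.symm ν⟩) →
        ∀ (hn : 1 ≤ (ℓ + 1) ^ k) (a m2 : ℝ), amin ≤ a → a ≤ aplus → 0 ≤ m2 → m2 ≤ m2plus →
        ∀ (μ : Fin (d + 1)) (x x' : ↥(fineDom ((ℓ + 1) ^ k) Ωc)), x.1 + e1 μ ∈ fineDom ((ℓ + 1) ^ k) Ωc →
          x'.1 + e1 μ ∈ fineDom ((ℓ + 1) ^ k) Ωc → x'.1 ≠ x.1 →
        ∀ (l : List ↥(fineDom ((ℓ + 1) ^ k) Ωc)), IsNNChain x l → pathEnd x l = x' →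
          (l.length : ℝ) ≤ ((d : ℝ) + 1) * supNorm (x'.1 - x.1) →
          (∀ z ∈ l, supNorm (z.1 - x.1) ≤ supNorm (x'.1 - x.1)) →
          (∀ y : Fin (d + 1) → ℤ, (∀ ν, |y ν - blk ((ℓ + 1) ^ k) x.1 ν| ≤ (K₀ : ℤ) * (d + 4)) → y ∈ Ωc) →
          (∀ y : Fin (d + 1) → ℤ, (∀ ν, |y ν - blk ((ℓ + 1) ^ k) x'.1 ν| ≤ (K₀ : ℤ) * (d + 4)) → y ∈ Ωc) →
        ∀ (S : ↥(fineDom ((ℓ + 1) ^ k) Ωc) → Prop) (D : ℝ),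
          (∀ x'', S x'' → ∃ ν, D ≤ |rpos ((ℓ + 1) ^ k) Ωc x ν - rpos ((ℓ + 1) ^ k) Ωc x'' ν|) →
          (∀ x'', S x'' → ∃ ν, D ≤ |rpos ((ℓ + 1) ^ k) Ωc x' ν - rpos ((ℓ + 1) ^ k) Ωc x'' ν|) →
        ∀ (f : ↥(fineDom ((ℓ + 1) ^ k) Ωc) × Fin 2 → ℝ), (∀ p, ¬ S p.1 → f p = 0) →
        ∀ i : Fin 2,
          ((((ℓ + 1) ^ k : ℕ) : ℝ) / supNorm (x'.1 - x.1)) ^ α *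
            |(transport (fieldLink OrthFlow.rot (e₀ / ((ℓ + 1) ^ k : ℕ)) (acBond Ωc Ac')) x l
                *ᵥ fld (regionDeriv OrthFlow.rot e₀ ((ℓ + 1) ^ k) Ωc Ac' μ
                      *ᵥ ((regionOp OrthFlow.rot e₀ hn (B1.aSeq a ((ℓ : ℝ) + 1) k) m2 Ωc Ac')⁻¹ *ᵥ f)) x'
              - fld (regionDeriv OrthFlow.rot e₀ ((ℓ + 1) ^ k) Ωc Ac' μ
                      *ᵥ ((regionOp OrthFlow.rot e₀ hn (B1.aSeq a ((ℓ : ℝ) + 1) k) m2 Ωc Ac')⁻¹ *ᵥ f)) x) i|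
            ≤ c₀ * Real.exp (-(D / (2 * ((((ℓ + 1) ^ k : ℕ) : ℝ) * K₀)))) * ‖f‖ := by
  obtain ⟨K₀, hK16, h8, c₀, hc₀, H⟩ :=
    thm19_holder_region_all_allF OrthFlow.rot zero_le_one rot_lipschitz d ℓ hℓ amin aplus m2plus ha α hα0 hα1
  refine ⟨K₀, hK16, h8, 4 * c₀, by positivity, fun c β hc hβ0 hβ1 => ?_⟩
  obtain ⟨e₁', he₁', H'⟩ := H c β hc.le hβ0
  obtain ⟨e₁, he₁, hall⟩ := exists_smooth_gauge_links hd hℓ hodd pexp n hβ1 hc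
  refine ⟨min e₁ e₁', lt_min he₁ he₁', fun P hPd hPL k hk1 hk e₀ he hle v hv lo hi hbox hnN Ωc hBU hΩ Ac' hlog hn a m2 ha1 ha2 hm1 hm2
    μ x x' hxμ hx'μ hne l hl hlend hlen hlnear hRx hRx' S D hD hD' f hf i => ?_⟩
  obtain ⟨lam, A, hreg, hlinks⟩ := hall P hPd hPL k hk1 hk e₀ he (hle.trans (min_le_left _ _)) v hv lo hi hbox hnN Ωc hΩ
  have hlink := hlinks Ac' hlog
  obtain ⟨g, hg_def⟩ : ∃ g : ↥(fineDom ((ℓ + 1) ^ k) Ωc) → Matrix (Fin 2) (Fin 2) ℝ, g = fun u => OrthFlow.rot.U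
      (e₀ / (((ℓ + 1) ^ k : ℕ) : ℝ) * -((((ℓ + 1) ^ k : ℕ) : ℝ) * lam (castSite (fun j : Fin P.d => u.1 (Fin.cast hPd j))))) :=
    ⟨_, rfl⟩
  have hg : IsGauge g := by rw [hg_def]; exact OrthFlow.rot.isGauge _
  have hop : regionOp OrthFlow.rot e₀ hn (B1.aSeq a ((ℓ : ℝ) + 1) k) m2 Ωc Ac'
      = blockDiag g * regionOp OrthFlow.rot e₀ hn (B1.aSeq a ((ℓ : ℝ) + 1) k) m2 Ωc
          (fun x ν => A ⟨castSite (fun j : Fin P.d => x (Fin.cast hPd j)), Fin.cast hPd.symm ν⟩) * (blockDiag g)ᵀ := by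
    rw [hg_def]
    exact regionOp_gauge OrthFlow.rot e₀ hn (B1.aSeq a ((ℓ : ℝ) + 1) k) m2 Ωc
      (Ac := fun x ν => A ⟨castSite (fun j : Fin P.d => x (Fin.cast hPd j)), Fin.cast hPd.symm ν⟩)
      (σ := fun x => -((((ℓ + 1) ^ k : ℕ) : ℝ) * lam (castSite (fun j : Fin P.d => x (Fin.cast hPd j))))) hlink
  have hDer : regionDeriv OrthFlow.rot e₀ ((ℓ + 1) ^ k) Ωc Ac' μ
      = blockDiag g * regionDeriv OrthFlow.rot e₀ ((ℓ + 1) ^ k) Ωc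
          (fun x ν => A ⟨castSite (fun j : Fin P.d => x (Fin.cast hPd j)), Fin.cast hPd.symm ν⟩) μ * (blockDiag g)ᵀ := by
    rw [hg_def]
    exact regionDeriv_gauge OrthFlow.rot e₀ ((ℓ + 1) ^ k) Ωc
      (Ac := fun x ν => A ⟨castSite (fun j : Fin P.d => x (Fin.cast hPd j)), Fin.cast hPd.symm ν⟩)
      (σ := fun x => -((((ℓ + 1) ^ k : ℕ) : ℝ) * lam (castSite (fun j : Fin P.d => x (Fin.cast hPd j))))) hlink μ
  have hT : transport (fieldLink OrthFlow.rot (e₀ / ((ℓ + 1) ^ k : ℕ)) (acBond Ωc Ac')) x l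
      = g x * transport (fieldLink OrthFlow.rot (e₀ / ((ℓ + 1) ^ k : ℕ))
          (acBond Ωc fun x ν => A ⟨castSite (fun j : Fin P.d => x (Fin.cast hPd j)), Fin.cast hPd.symm ν⟩)) x l
          * (g x')ᵀ := by
    rw [hg_def, ← hlend]
    exact transport_acBond_gauge OrthFlow.rot e₀ ((ℓ + 1) ^ k) Ωc
      (Ac := fun x ν => A ⟨castSite (fun j : Fin P.d => x (Fin.cast hPd j)), Fin.cast hPd.symm ν⟩)
      (σ := fun x => -((((ℓ + 1) ^ k : ℕ) : ℝ) * lam (castSite (fun j : Fin P.d => x (Fin.cast hPd j))))) hlink x l hl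
  have hfT : ∀ p : ↥(fineDom ((ℓ + 1) ^ k) Ωc) × Fin 2, ¬ S p.1 → ((blockDiag g)ᵀ *ᵥ f) p = 0 := by
    rintro ⟨y, j⟩ hy
    rw [blockDiagT_mulVec_apply]
    exact Finset.sum_eq_zero fun j' _ => by rw [hf (y, j') hy, mul_zero]
  have hw : 0 ≤ ((((ℓ + 1) ^ k : ℕ) : ℝ) / supNorm (x'.1 - x.1)) ^ α :=
    Real.rpow_nonneg (div_nonneg (Nat.cast_nonneg _) (supNorm_nonneg _)) α
  rw [hop, hDer, hT, conj_inv hg, conj_deriv_green_mulVec hg, holderExpr_conj hg]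
  have hE : 0 ≤ c₀ * Real.exp (-(D / (2 * ((((ℓ + 1) ^ k : ℕ) : ℝ) * K₀)))) := by positivity
  have hnT := norm_blockDiagT_mulVec_le hg f
  simp only [Fintype.card_fin, Nat.cast_ofNat] at hnT
  have key := fun j : Fin 2 =>
    (H' k hk1 hn a m2 ha1 ha2 hm1 hm2 Ωc hBU
      (fun x ν => A ⟨castSite (fun j : Fin P.d => x (Fin.cast hPd j)), Fin.cast hPd.symm ν⟩) e₀ he
      (hle.trans (min_le_right _ _)) hreg μ x x' hxμ hx'μ hne l hl hlend hlen hlnear hRx hRx' S D hD hD' _ hfT j).trans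
      (mul_le_mul_of_nonneg_left hnT hE)
  refine (mul_le_mul_of_nonneg_left (abs_gauge_mulVec_le hg x _ i) hw).trans ?_
  rw [Finset.mul_sum]
  refine (Finset.sum_le_sum fun j _ => key j).trans (le_of_eq ?_)
  simp only [Finset.sum_const, Finset.card_univ, Fintype.card_fin, nsmul_eq_mul, Nat.cast_ofNat]
  ring

end Thm19

/-! ## §6  (1.11)–(1.12), value member, arbitrary source, for the pair `Ω ⊂ Ω₀` at the actual background -/

section Thm112

variable {d : ℕ}

/-- **THEOREM (1.11)–(1.12), VALUE member, FOR `δG_k(Ω, Ω₀, u_k)` AT THE ACTUAL BACKGROUND, ARBITRARY SOURCE**: r01's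
`B4Thm110RegionAllF.thm112_value_region_allF` (`Ω ⊂ Ω₀` unions of `K₀`-blocks; `x ∈ Ω` under `R₀`; `f` on `Ω₀` vanishing off a set at
`ℓ^∞`-distance `≥ D` from `x` and `≥ D₁` from `Ω₀ ∖ Ω`; `x` at distance `≥ D₀` from `Ω₀ ∖ Ω`) TRANSFERRED to the Green's functions of BOTH
regions built from `u_k`'s bond variables (any logarithm field `A′` of `u_k` on `Ω₀`; both operators are conjugated by the same sitewise gauge):
`|(G_k(Ω,u_k)(f|_Ω))(x)_i − (G_k(Ω₀,u_k)f)(x)_i| ≤ c₀·e^{−(D₀+D₁)/(2(ℓ+1)^kK₀)}·e^{−D/(4(ℓ+1)^kK₀)}·‖f‖_∞` — *"(1.10) [for δG_k] with the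
additional factor exp(−δ₀dist(x,Ωᶜ) − δ₀dist(supp f,Ωᶜ)) (1.12)"*, for regions `Ω₀` inside a non-wrapping box of the torus.
[cite: BalabanImbrieJaffe1985, §7.3 p.326; Balaban1983RegularityDecay, Theorem (1.11)–(1.12) p.573] -/
theorem thm112_value_region_actualBg_allF {d ℓ : ℕ} (hd : 1 ≤ d) (hℓ : 1 ≤ ℓ) (hodd : Odd (ℓ + 1)) (pexp : ℝ) (n : ℕ)
    (amin aplus m2plus : ℝ) (ha : 0 < amin) :
    ∃ K₀ : ℕ, 8 ≤ K₀ ∧ 8 ∣ K₀ ∧ ∃ c₀ : ℝ, 0 < c₀ ∧ ∀ (c β : ℝ), 0 < c → 0 < β → β < 1 →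
      ∃ e₁ : ℝ, 0 < e₁ ∧ ∀ (P : Params) (hPd : P.d = d + 1), P.L = ℓ + 1 → ∀ (k : ℕ), 1 ≤ k → ∀ (hk : k ≤ P.m + P.K)
      (e₀ : ℝ), 0 < e₀ → e₀ ≤ e₁ →
      ∀ (v : U1Field P k), (∀ p : TPlaq P k, ‖((plaq v p : Circle) : ℂ) - 1‖ ≤ e₀ * (1 + Real.log e₀⁻¹) ^ pexp) →
      ∀ (lo hi : Fin P.d → ℤ), (∀ κ, hi κ ≤ lo κ + n) → n < P.sitesPerDir 0 →
      ∀ (Ω₀c Ωc : Finset (Fin (d + 1) → ℤ)), IsBlockUnion K₀ Ω₀c → IsBlockUnion K₀ Ωc → ∀ (hsub : Ωc ⊆ Ω₀c),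
        (∀ y ∈ Ω₀c, ∀ i : Fin (d + 1),
          lo (Fin.cast hPd.symm i) ≤ (P.L : ℤ) ^ k * y i ∧ (P.L : ℤ) ^ k * y i + (P.L : ℤ) ^ k ≤ hi (Fin.cast hPd.symm i)) →
      ∀ (Ac' : (Fin (d + 1) → ℤ) → Fin (d + 1) → ℝ),
        (∀ x ∈ fineDom ((ℓ + 1) ^ k) Ω₀c, ∀ ν : Fin (d + 1), x + e1 ν ∈ fineDom ((ℓ + 1) ^ k) Ω₀c →
          Circle.exp (e₀ / (((ℓ + 1) ^ k : ℕ) : ℝ) * Ac' x ν) =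
            actualBg ((Nat.succ_le_succ hd).trans_eq hPd.symm) k e₀ v
              ⟨castSite (fun j : Fin P.d => x (Fin.cast hPd j)), Fin.cast hPd.symm ν⟩) →
        ∀ (hn : 1 ≤ (ℓ + 1) ^ k) (a m2 : ℝ), amin ≤ a → a ≤ aplus → 0 ≤ m2 → m2 ≤ m2plus →
        ∀ (x : ↥(fineDom ((ℓ + 1) ^ k) Ωc)),
          (∀ y : Fin (d + 1) → ℤ, (∀ μ, |y μ - blk ((ℓ + 1) ^ k) x.1 μ| ≤ (K₀ : ℤ) * (d + 3)) → y ∈ Ωc) →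
        ∀ (S : ↥(fineDom ((ℓ + 1) ^ k) Ω₀c) → Prop) (D D₀ D₁ : ℝ),
          (∀ x', S x' → ∃ μ, D ≤ |rpos ((ℓ + 1) ^ k) Ω₀c (incl hn hsub x) μ - rpos ((ℓ + 1) ^ k) Ω₀c x' μ|) →
          (∀ x₁ : ↥(fineDom ((ℓ + 1) ^ k) Ω₀c), ¬ inReg ((ℓ + 1) ^ k) Ωc x₁ →
            ∃ μ, D₀ ≤ |rpos ((ℓ + 1) ^ k) Ω₀c (incl hn hsub x) μ - rpos ((ℓ + 1) ^ k) Ω₀c x₁ μ|) →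
          (∀ x', S x' → ∀ x₁ : ↥(fineDom ((ℓ + 1) ^ k) Ω₀c), ¬ inReg ((ℓ + 1) ^ k) Ωc x₁ →
            ∃ μ, D₁ ≤ |rpos ((ℓ + 1) ^ k) Ω₀c x₁ μ - rpos ((ℓ + 1) ^ k) Ω₀c x' μ|) →
        ∀ (f : ↥(fineDom ((ℓ + 1) ^ k) Ω₀c) × Fin 2 → ℝ), (∀ p, ¬ S p.1 → f p = 0) →
        ∀ i : Fin 2,
          |((regionOp OrthFlow.rot e₀ hn (B1.aSeq a ((ℓ : ℝ) + 1) k) m2 Ωc Ac')⁻¹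
                *ᵥ (fun q : ↥(fineDom ((ℓ + 1) ^ k) Ωc) × Fin 2 => f (incl hn hsub q.1, q.2))) (x, i)
            - ((regionOp OrthFlow.rot e₀ hn (B1.aSeq a ((ℓ : ℝ) + 1) k) m2 Ω₀c Ac')⁻¹ *ᵥ f) (incl hn hsub x, i)|
            ≤ c₀ * Real.exp (-((D₀ + D₁) / (2 * ((((ℓ + 1) ^ k : ℕ) : ℝ) * K₀))))
              * Real.exp (-(D / (4 * ((((ℓ + 1) ^ k : ℕ) : ℝ) * K₀)))) * ‖f‖ := by
  obtain ⟨K₀, hK8, h8, c₀, hc₀, H⟩ := thm112_value_region_allF OrthFlow.rot zero_le_one rot_lipschitz d ℓ hℓ amin aplus m2plus ha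
  refine ⟨K₀, hK8, h8, 4 * c₀, by positivity, fun c β hc hβ0 hβ1 => ?_⟩
  obtain ⟨e₁', he₁', H'⟩ := H c β hc.le hβ0
  obtain ⟨e₁, he₁, hall⟩ := exists_smooth_gauge_links hd hℓ hodd pexp n hβ1 hc
  refine ⟨min e₁ e₁', lt_min he₁ he₁', fun P hPd hPL k hk1 hk e₀ he hle v hv lo hi hbox hnN Ω₀c Ωc hBU₀ hBU hsub hΩ₀ Ac' hlog hn a m2
    ha1 ha2 hm1 hm2 x hR S D D₀ D₁ hD hD₀ hD₁ f hf i => ?_⟩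
  -- the smooth gauge on the LARGER region `Ω₀` (it serves `Ω ⊂ Ω₀` as well)
  obtain ⟨lam, A, hreg, hlinks⟩ := hall P hPd hPL k hk1 hk e₀ he (hle.trans (min_le_left _ _)) v hv lo hi hbox hnN Ω₀c hΩ₀
  have hlink₀ := hlinks Ac' hlog
  have hmono : fineDom ((ℓ + 1) ^ k) Ωc ⊆ fineDom ((ℓ + 1) ^ k) Ω₀c := fun z hz =>
    (mem_fineDom hn).mpr (hsub ((mem_fineDom hn).mp hz))
  have hlink : ∀ x ∈ fineDom ((ℓ + 1) ^ k) Ωc, ∀ ν : Fin (d + 1), x + e1 ν ∈ fineDom ((ℓ + 1) ^ k) Ωc →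
      OrthFlow.rot.U (e₀ / (((ℓ + 1) ^ k : ℕ) : ℝ) * Ac' x ν)
        = OrthFlow.rot.U (e₀ / (((ℓ + 1) ^ k : ℕ) : ℝ) *
            (A ⟨castSite (fun j : Fin P.d => x (Fin.cast hPd j)), Fin.cast hPd.symm ν⟩
              + -((((ℓ + 1) ^ k : ℕ) : ℝ) * lam (castSite (fun j : Fin P.d => x (Fin.cast hPd j))))
              - -((((ℓ + 1) ^ k : ℕ) : ℝ) * lam (castSite (fun j : Fin P.d => (x + e1 ν) (Fin.cast hPd j)))))) :=
    fun x hx ν hν => hlink₀ x (hmono hx) ν (hmono hν)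
  -- one sitewise gauge, restricted to either region
  obtain ⟨g₀, hg₀_def⟩ : ∃ g₀ : ↥(fineDom ((ℓ + 1) ^ k) Ω₀c) → Matrix (Fin 2) (Fin 2) ℝ, g₀ = fun u => OrthFlow.rot.U
      (e₀ / (((ℓ + 1) ^ k : ℕ) : ℝ) * -((((ℓ + 1) ^ k : ℕ) : ℝ) * lam (castSite (fun j : Fin P.d => u.1 (Fin.cast hPd j))))) :=
    ⟨_, rfl⟩
  obtain ⟨g, hg_def⟩ : ∃ g : ↥(fineDom ((ℓ + 1) ^ k) Ωc) → Matrix (Fin 2) (Fin 2) ℝ, g = fun u => OrthFlow.rot.U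
      (e₀ / (((ℓ + 1) ^ k : ℕ) : ℝ) * -((((ℓ + 1) ^ k : ℕ) : ℝ) * lam (castSite (fun j : Fin P.d => u.1 (Fin.cast hPd j))))) :=
    ⟨_, rfl⟩
  have hg₀ : IsGauge g₀ := by rw [hg₀_def]; exact OrthFlow.rot.isGauge _
  have hg : IsGauge g := by rw [hg_def]; exact OrthFlow.rot.isGauge _
  have hgg : ∀ q : ↥(fineDom ((ℓ + 1) ^ k) Ωc), g q = g₀ (incl hn hsub q) := fun q => by rw [hg_def, hg₀_def]; rfl
  have hop₀ : regionOp OrthFlow.rot e₀ hn (B1.aSeq a ((ℓ : ℝ) + 1) k) m2 Ω₀c Ac'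
      = blockDiag g₀ * regionOp OrthFlow.rot e₀ hn (B1.aSeq a ((ℓ : ℝ) + 1) k) m2 Ω₀c
          (fun x ν => A ⟨castSite (fun j : Fin P.d => x (Fin.cast hPd j)), Fin.cast hPd.symm ν⟩) * (blockDiag g₀)ᵀ := by
    rw [hg₀_def]
    exact regionOp_gauge OrthFlow.rot e₀ hn (B1.aSeq a ((ℓ : ℝ) + 1) k) m2 Ω₀c
      (Ac := fun x ν => A ⟨castSite (fun j : Fin P.d => x (Fin.cast hPd j)), Fin.cast hPd.symm ν⟩)
      (σ := fun x => -((((ℓ + 1) ^ k : ℕ) : ℝ) * lam (castSite (fun j : Fin P.d => x (Fin.cast hPd j))))) hlink₀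
  have hop : regionOp OrthFlow.rot e₀ hn (B1.aSeq a ((ℓ : ℝ) + 1) k) m2 Ωc Ac'
      = blockDiag g * regionOp OrthFlow.rot e₀ hn (B1.aSeq a ((ℓ : ℝ) + 1) k) m2 Ωc
          (fun x ν => A ⟨castSite (fun j : Fin P.d => x (Fin.cast hPd j)), Fin.cast hPd.symm ν⟩) * (blockDiag g)ᵀ := by
    rw [hg_def]
    exact regionOp_gauge OrthFlow.rot e₀ hn (B1.aSeq a ((ℓ : ℝ) + 1) k) m2 Ωc
      (Ac := fun x ν => A ⟨castSite (fun j : Fin P.d => x (Fin.cast hPd j)), Fin.cast hPd.symm ν⟩)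
      (σ := fun x => -((((ℓ + 1) ^ k : ℕ) : ℝ) * lam (castSite (fun j : Fin P.d => x (Fin.cast hPd j))))) hlink
  -- the restricted transformed source is the transform of the restricted source
  have hres : (fun q : ↥(fineDom ((ℓ + 1) ^ k) Ωc) × Fin 2 => ((blockDiag g₀)ᵀ *ᵥ f) (incl hn hsub q.1, q.2))
      = (blockDiag g)ᵀ *ᵥ (fun q : ↥(fineDom ((ℓ + 1) ^ k) Ωc) × Fin 2 => f (incl hn hsub q.1, q.2)) := by
    funext q
    obtain ⟨y, j⟩ := q
    rw [blockDiagT_mulVec_apply, blockDiagT_mulVec_apply, hgg]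
  have hfT : ∀ p : ↥(fineDom ((ℓ + 1) ^ k) Ω₀c) × Fin 2, ¬ S p.1 → ((blockDiag g₀)ᵀ *ᵥ f) p = 0 := by
    rintro ⟨y, j⟩ hy
    rw [blockDiagT_mulVec_apply]
    exact Finset.sum_eq_zero fun j' _ => by rw [hf (y, j') hy, mul_zero]
  -- conjugate both Green's functions; the difference at `x` is `g(x)` applied to the difference of the smooth-gauge quantities at `𝒢₀ᵀf`
  have hval : ∀ j : Fin 2,
      ((regionOp OrthFlow.rot e₀ hn (B1.aSeq a ((ℓ : ℝ) + 1) k) m2 Ωc Ac')⁻¹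
          *ᵥ (fun q : ↥(fineDom ((ℓ + 1) ^ k) Ωc) × Fin 2 => f (incl hn hsub q.1, q.2))) (x, j)
        - ((regionOp OrthFlow.rot e₀ hn (B1.aSeq a ((ℓ : ℝ) + 1) k) m2 Ω₀c Ac')⁻¹ *ᵥ f) (incl hn hsub x, j)
      = (g x *ᵥ (fld ((regionOp OrthFlow.rot e₀ hn (B1.aSeq a ((ℓ : ℝ) + 1) k) m2 Ωc
            (fun x ν => A ⟨castSite (fun j : Fin P.d => x (Fin.cast hPd j)), Fin.cast hPd.symm ν⟩))⁻¹
            *ᵥ ((blockDiag g)ᵀ *ᵥ fun q : ↥(fineDom ((ℓ + 1) ^ k) Ωc) × Fin 2 => f (incl hn hsub q.1, q.2))) x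
          - fld ((regionOp OrthFlow.rot e₀ hn (B1.aSeq a ((ℓ : ℝ) + 1) k) m2 Ω₀c
            (fun x ν => A ⟨castSite (fun j : Fin P.d => x (Fin.cast hPd j)), Fin.cast hPd.symm ν⟩))⁻¹
            *ᵥ ((blockDiag g₀)ᵀ *ᵥ f)) (incl hn hsub x))) j := by
    intro j
    have h1 := congrFun (fld_blockDiag_mulVec g
      ((regionOp OrthFlow.rot e₀ hn (B1.aSeq a ((ℓ : ℝ) + 1) k) m2 Ωc
        (fun x ν => A ⟨castSite (fun j : Fin P.d => x (Fin.cast hPd j)), Fin.cast hPd.symm ν⟩))⁻¹ *ᵥ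
          ((blockDiag g)ᵀ *ᵥ fun q : ↥(fineDom ((ℓ + 1) ^ k) Ωc) × Fin 2 => f (incl hn hsub q.1, q.2))) x) j
    have h2 := congrFun (fld_blockDiag_mulVec g₀
      ((regionOp OrthFlow.rot e₀ hn (B1.aSeq a ((ℓ : ℝ) + 1) k) m2 Ω₀c
        (fun x ν => A ⟨castSite (fun j : Fin P.d => x (Fin.cast hPd j)), Fin.cast hPd.symm ν⟩))⁻¹ *ᵥ
          ((blockDiag g₀)ᵀ *ᵥ f)) (incl hn hsub x)) j
    simp only [fld_apply] at h1 h2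
    rw [hop, hop₀, conj_inv hg, conj_inv hg₀, ← Matrix.mulVec_mulVec, ← Matrix.mulVec_mulVec, ← Matrix.mulVec_mulVec,
      ← Matrix.mulVec_mulVec, Matrix.mulVec_sub, Pi.sub_apply, h1, h2, ← hgg x]
  rw [hval i]
  refine (abs_gauge_mulVec_le hg x _ i).trans ?_
  have hE : 0 ≤ c₀ * Real.exp (-((D₀ + D₁) / (2 * ((((ℓ + 1) ^ k : ℕ) : ℝ) * K₀))))
      * Real.exp (-(D / (4 * ((((ℓ + 1) ^ k : ℕ) : ℝ) * K₀)))) := by positivity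
  have hnT := norm_blockDiagT_mulVec_le hg₀ f
  simp only [Fintype.card_fin, Nat.cast_ofNat] at hnT
  have key := fun j' : Fin 2 =>
    (H' k hk1 hn a m2 ha1 ha2 hm1 hm2 Ω₀c Ωc hBU₀ hBU hsub
      (fun x ν => A ⟨castSite (fun j : Fin P.d => x (Fin.cast hPd j)), Fin.cast hPd.symm ν⟩) e₀ he
      (hle.trans (min_le_right _ _)) hreg x hR S D D₀ D₁ hD hD₀ hD₁ _ hfT j').trans (mul_le_mul_of_nonneg_left hnT hE)
  rw [← hres]
  simp only [Pi.sub_apply, fld_apply]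
  refine (Finset.sum_le_sum fun j' _ => key j').trans (le_of_eq ?_)
  simp only [Finset.sum_const, Finset.card_univ, Fintype.card_fin, nsmul_eq_mul, Nat.cast_ofNat]
  ring

end Thm112

/-! ## §7  (1.11)–(1.12), derivative and Hölder members, arbitrary source, for the pair `Ω ⊂ Ω₀` at the actual background -/

section Thm112DH

variable {X X₀ ι : Type*} {d : ℕ}

/-- two-region conjugation, values: `(𝒢Ψ)(x)_i − (𝒢₀Ψ₀)(x₀)_i = (g(x)(Ψ(x) − Ψ₀(x₀)))_i` when `g(x) = g₀(x₀)`.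
[cite: Balaban1983RegularityDecay, (1.11)–(1.12) p.573; pp.580–581] -/
theorem gauge_pair_apply [Fintype X] [Fintype X₀] [Fintype ι] [DecidableEq X] [DecidableEq X₀] {g : X → Matrix ι ι ℝ}
    {g₀ : X₀ → Matrix ι ι ℝ} {x : X} {x₀ : X₀} (hgx : g x = g₀ x₀) (Ψ : X × ι → ℝ) (Ψ₀ : X₀ × ι → ℝ) (i : ι) :
    (blockDiag g *ᵥ Ψ) (x, i) - (blockDiag g₀ *ᵥ Ψ₀) (x₀, i) = (g x *ᵥ (fld Ψ x - fld Ψ₀ x₀)) i := by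
  have h1 := congrFun (fld_blockDiag_mulVec g Ψ x) i
  have h2 := congrFun (fld_blockDiag_mulVec g₀ Ψ₀ x₀) i
  simp only [fld_apply] at h1 h2
  rw [h1, h2, ← hgx, Matrix.mulVec_sub, Pi.sub_apply]

/-- two-region conjugation, Hölder differences: with `T′ = g(x)Tg(x′)ᵀ`, `g(x) = g₀(x₀)`, `g(x′) = g₀(x₀′)`:
`T′(𝒢Ψ)(x′) − (𝒢Ψ)(x) − (T′(𝒢₀Ψ₀)(x₀′) − (𝒢₀Ψ₀)(x₀)) = g(x)·(TΨ(x′) − Ψ(x) − (TΨ₀(x₀′) − Ψ₀(x₀)))`.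
[cite: Balaban1983RegularityDecay, (1.9), (1.11)–(1.12) p.573; pp.580–581] -/
theorem gauge_holderPair [Fintype X] [Fintype X₀] [Fintype ι] [DecidableEq X] [DecidableEq X₀] [DecidableEq ι]
    {g : X → Matrix ι ι ℝ} {g₀ : X₀ → Matrix ι ι ℝ} (hg : IsGauge g) (hg₀ : IsGauge g₀) {x x' : X} {x₀ x₀' : X₀}
    (hgx : g x = g₀ x₀) (hgx' : g x' = g₀ x₀') (T : Matrix ι ι ℝ) (Ψ : X × ι → ℝ) (Ψ₀ : X₀ × ι → ℝ) :
    (g x * T * (g x')ᵀ) *ᵥ fld (blockDiag g *ᵥ Ψ) x' - fld (blockDiag g *ᵥ Ψ) x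
        - ((g x * T * (g x')ᵀ) *ᵥ fld (blockDiag g₀ *ᵥ Ψ₀) x₀' - fld (blockDiag g₀ *ᵥ Ψ₀) x₀)
      = g x *ᵥ (T *ᵥ fld Ψ x' - fld Ψ x - (T *ᵥ fld Ψ₀ x₀' - fld Ψ₀ x₀)) := by
  rw [holderExpr_conj hg, hgx, hgx', holderExpr_conj hg₀, ← Matrix.mulVec_sub]

/-- **THEOREM (1.11)–(1.12), DERIVATIVE member, FOR `δG_k(Ω, Ω₀, u_k)` AT THE ACTUAL BACKGROUND, ARBITRARY SOURCE** — r01's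
`B4Thm112RegionAllF.thm112_deriv_region_allF` transferred (pair `Ω ⊂ Ω₀` of `K₀`-block unions inside a non-wrapping box, `x, x + e_μ ∈ Ω`
under `R₀`, any logarithm field `A′` of `u_k` on `Ω₀`):
`|(D^η_{u_k,μ}G_k(Ω,u_k)(f|_Ω))(x)_i − (D^η_{u_k,μ}G_k(Ω₀,u_k)f)(x)_i| ≤ c₀·e^{−(D₀+D₁)/(2(ℓ+1)^kK₀)}·e^{−D/(4(ℓ+1)^kK₀)}·‖f‖_∞`.
[cite: BalabanImbrieJaffe1985, §7.3 p.326; Balaban1983RegularityDecay, Theorem (1.10)–(1.12) p.573] -/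
theorem thm112_deriv_region_actualBg_allF {d ℓ : ℕ} (hd : 1 ≤ d) (hℓ : 1 ≤ ℓ) (hodd : Odd (ℓ + 1)) (pexp : ℝ) (n : ℕ)
    (amin aplus m2plus : ℝ) (ha : 0 < amin) :
    ∃ K₀ : ℕ, 8 ≤ K₀ ∧ 8 ∣ K₀ ∧ ∃ c₀ : ℝ, 0 < c₀ ∧ ∀ (c β : ℝ), 0 < c → 0 < β → β < 1 →
      ∃ e₁ : ℝ, 0 < e₁ ∧ ∀ (P : Params) (hPd : P.d = d + 1), P.L = ℓ + 1 → ∀ (k : ℕ), 1 ≤ k → ∀ (hk : k ≤ P.m + P.K)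
      (e₀ : ℝ), 0 < e₀ → e₀ ≤ e₁ →
      ∀ (v : U1Field P k), (∀ p : TPlaq P k, ‖((plaq v p : Circle) : ℂ) - 1‖ ≤ e₀ * (1 + Real.log e₀⁻¹) ^ pexp) →
      ∀ (lo hi : Fin P.d → ℤ), (∀ κ, hi κ ≤ lo κ + n) → n < P.sitesPerDir 0 →
      ∀ (Ω₀c Ωc : Finset (Fin (d + 1) → ℤ)), IsBlockUnion K₀ Ω₀c → IsBlockUnion K₀ Ωc → ∀ (hsub : Ωc ⊆ Ω₀c),
        (∀ y ∈ Ω₀c, ∀ i : Fin (d + 1),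
          lo (Fin.cast hPd.symm i) ≤ (P.L : ℤ) ^ k * y i ∧ (P.L : ℤ) ^ k * y i + (P.L : ℤ) ^ k ≤ hi (Fin.cast hPd.symm i)) →
      ∀ (Ac' : (Fin (d + 1) → ℤ) → Fin (d + 1) → ℝ),
        (∀ x ∈ fineDom ((ℓ + 1) ^ k) Ω₀c, ∀ ν : Fin (d + 1), x + e1 ν ∈ fineDom ((ℓ + 1) ^ k) Ω₀c →
          Circle.exp (e₀ / (((ℓ + 1) ^ k : ℕ) : ℝ) * Ac' x ν) =
            actualBg ((Nat.succ_le_succ hd).trans_eq hPd.symm) k e₀ v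
              ⟨castSite (fun j : Fin P.d => x (Fin.cast hPd j)), Fin.cast hPd.symm ν⟩) →
        ∀ (hn : 1 ≤ (ℓ + 1) ^ k) (a m2 : ℝ), amin ≤ a → a ≤ aplus → 0 ≤ m2 → m2 ≤ m2plus →
        ∀ (μ : Fin (d + 1)) (x : ↥(fineDom ((ℓ + 1) ^ k) Ωc)), x.1 + e1 μ ∈ fineDom ((ℓ + 1) ^ k) Ωc →
          (∀ y : Fin (d + 1) → ℤ, (∀ ν, |y ν - blk ((ℓ + 1) ^ k) x.1 ν| ≤ (K₀ : ℤ) * (d + 3) + 1) → y ∈ Ωc) →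
        ∀ (S : ↥(fineDom ((ℓ + 1) ^ k) Ω₀c) → Prop) (D D₀ D₁ : ℝ),
          (∀ x', S x' → ∃ ν, D ≤ |rpos ((ℓ + 1) ^ k) Ω₀c (incl hn hsub x) ν - rpos ((ℓ + 1) ^ k) Ω₀c x' ν|) →
          (∀ x₁ : ↥(fineDom ((ℓ + 1) ^ k) Ω₀c), ¬ inReg ((ℓ + 1) ^ k) Ωc x₁ →
            ∃ ν, D₀ ≤ |rpos ((ℓ + 1) ^ k) Ω₀c (incl hn hsub x) ν - rpos ((ℓ + 1) ^ k) Ω₀c x₁ ν|) →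
          (∀ x', S x' → ∀ x₁ : ↥(fineDom ((ℓ + 1) ^ k) Ω₀c), ¬ inReg ((ℓ + 1) ^ k) Ωc x₁ →
            ∃ ν, D₁ ≤ |rpos ((ℓ + 1) ^ k) Ω₀c x₁ ν - rpos ((ℓ + 1) ^ k) Ω₀c x' ν|) →
        ∀ (f : ↥(fineDom ((ℓ + 1) ^ k) Ω₀c) × Fin 2 → ℝ), (∀ p, ¬ S p.1 → f p = 0) →
        ∀ i : Fin 2,
          |(regionDeriv OrthFlow.rot e₀ ((ℓ + 1) ^ k) Ωc Ac' μ
                *ᵥ ((regionOp OrthFlow.rot e₀ hn (B1.aSeq a ((ℓ : ℝ) + 1) k) m2 Ωc Ac')⁻¹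
                  *ᵥ (fun q : ↥(fineDom ((ℓ + 1) ^ k) Ωc) × Fin 2 => f (incl hn hsub q.1, q.2)))) (x, i)
            - (regionDeriv OrthFlow.rot e₀ ((ℓ + 1) ^ k) Ω₀c Ac' μ
                *ᵥ ((regionOp OrthFlow.rot e₀ hn (B1.aSeq a ((ℓ : ℝ) + 1) k) m2 Ω₀c Ac')⁻¹ *ᵥ f)) (incl hn hsub x, i)|
            ≤ c₀ * Real.exp (-((D₀ + D₁) / (2 * ((((ℓ + 1) ^ k : ℕ) : ℝ) * K₀))))
              * Real.exp (-(D / (4 * ((((ℓ + 1) ^ k : ℕ) : ℝ) * K₀)))) * ‖f‖ := by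
  obtain ⟨K₀, hK8, h8, c₀, hc₀, H⟩ := thm112_deriv_region_allF OrthFlow.rot zero_le_one rot_lipschitz d ℓ hℓ amin aplus m2plus ha
  refine ⟨K₀, hK8, h8, 4 * c₀, by positivity, fun c β hc hβ0 hβ1 => ?_⟩
  obtain ⟨e₁', he₁', H'⟩ := H c β hc.le hβ0
  obtain ⟨e₁, he₁, hall⟩ := exists_smooth_gauge_links hd hℓ hodd pexp n hβ1 hc
  refine ⟨min e₁ e₁', lt_min he₁ he₁', fun P hPd hPL k hk1 hk e₀ he hle v hv lo hi hbox hnN Ω₀c Ωc hBU₀ hBU hsub hΩ₀ Ac' hlog hn a m2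
    ha1 ha2 hm1 hm2 μ x hxμ hR S D D₀ D₁ hD hD₀ hD₁ f hf i => ?_⟩
  obtain ⟨lam, A, hreg, hlinks⟩ := hall P hPd hPL k hk1 hk e₀ he (hle.trans (min_le_left _ _)) v hv lo hi hbox hnN Ω₀c hΩ₀
  have hlink₀ := hlinks Ac' hlog
  have hmono : fineDom ((ℓ + 1) ^ k) Ωc ⊆ fineDom ((ℓ + 1) ^ k) Ω₀c := fun z hz =>
    (mem_fineDom hn).mpr (hsub ((mem_fineDom hn).mp hz))
  have hlink : ∀ x ∈ fineDom ((ℓ + 1) ^ k) Ωc, ∀ ν : Fin (d + 1), x + e1 ν ∈ fineDom ((ℓ + 1) ^ k) Ωc →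
      OrthFlow.rot.U (e₀ / (((ℓ + 1) ^ k : ℕ) : ℝ) * Ac' x ν)
        = OrthFlow.rot.U (e₀ / (((ℓ + 1) ^ k : ℕ) : ℝ) *
            (A ⟨castSite (fun j : Fin P.d => x (Fin.cast hPd j)), Fin.cast hPd.symm ν⟩
              + -((((ℓ + 1) ^ k : ℕ) : ℝ) * lam (castSite (fun j : Fin P.d => x (Fin.cast hPd j))))
              - -((((ℓ + 1) ^ k : ℕ) : ℝ) * lam (castSite (fun j : Fin P.d => (x + e1 ν) (Fin.cast hPd j)))))) :=
    fun x hx ν hν => hlink₀ x (hmono hx) ν (hmono hν)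
  obtain ⟨g₀, hg₀_def⟩ : ∃ g₀ : ↥(fineDom ((ℓ + 1) ^ k) Ω₀c) → Matrix (Fin 2) (Fin 2) ℝ, g₀ = fun u => OrthFlow.rot.U
      (e₀ / (((ℓ + 1) ^ k : ℕ) : ℝ) * -((((ℓ + 1) ^ k : ℕ) : ℝ) * lam (castSite (fun j : Fin P.d => u.1 (Fin.cast hPd j))))) :=
    ⟨_, rfl⟩
  obtain ⟨g, hg_def⟩ : ∃ g : ↥(fineDom ((ℓ + 1) ^ k) Ωc) → Matrix (Fin 2) (Fin 2) ℝ, g = fun u => OrthFlow.rot.U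
      (e₀ / (((ℓ + 1) ^ k : ℕ) : ℝ) * -((((ℓ + 1) ^ k : ℕ) : ℝ) * lam (castSite (fun j : Fin P.d => u.1 (Fin.cast hPd j))))) :=
    ⟨_, rfl⟩
  have hg₀ : IsGauge g₀ := by rw [hg₀_def]; exact OrthFlow.rot.isGauge _
  have hg : IsGauge g := by rw [hg_def]; exact OrthFlow.rot.isGauge _
  have hgg : ∀ q : ↥(fineDom ((ℓ + 1) ^ k) Ωc), g q = g₀ (incl hn hsub q) := fun q => by rw [hg_def, hg₀_def]; rfl
  have hop₀ : regionOp OrthFlow.rot e₀ hn (B1.aSeq a ((ℓ : ℝ) + 1) k) m2 Ω₀c Ac'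
      = blockDiag g₀ * regionOp OrthFlow.rot e₀ hn (B1.aSeq a ((ℓ : ℝ) + 1) k) m2 Ω₀c
          (fun x ν => A ⟨castSite (fun j : Fin P.d => x (Fin.cast hPd j)), Fin.cast hPd.symm ν⟩) * (blockDiag g₀)ᵀ := by
    rw [hg₀_def]
    exact regionOp_gauge OrthFlow.rot e₀ hn (B1.aSeq a ((ℓ : ℝ) + 1) k) m2 Ω₀c
      (Ac := fun x ν => A ⟨castSite (fun j : Fin P.d => x (Fin.cast hPd j)), Fin.cast hPd.symm ν⟩)
      (σ := fun x => -((((ℓ + 1) ^ k : ℕ) : ℝ) * lam (castSite (fun j : Fin P.d => x (Fin.cast hPd j))))) hlink₀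
  have hop : regionOp OrthFlow.rot e₀ hn (B1.aSeq a ((ℓ : ℝ) + 1) k) m2 Ωc Ac'
      = blockDiag g * regionOp OrthFlow.rot e₀ hn (B1.aSeq a ((ℓ : ℝ) + 1) k) m2 Ωc
          (fun x ν => A ⟨castSite (fun j : Fin P.d => x (Fin.cast hPd j)), Fin.cast hPd.symm ν⟩) * (blockDiag g)ᵀ := by
    rw [hg_def]
    exact regionOp_gauge OrthFlow.rot e₀ hn (B1.aSeq a ((ℓ : ℝ) + 1) k) m2 Ωc
      (Ac := fun x ν => A ⟨castSite (fun j : Fin P.d => x (Fin.cast hPd j)), Fin.cast hPd.symm ν⟩)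
      (σ := fun x => -((((ℓ + 1) ^ k : ℕ) : ℝ) * lam (castSite (fun j : Fin P.d => x (Fin.cast hPd j))))) hlink
  have hDer₀ : regionDeriv OrthFlow.rot e₀ ((ℓ + 1) ^ k) Ω₀c Ac' μ
      = blockDiag g₀ * regionDeriv OrthFlow.rot e₀ ((ℓ + 1) ^ k) Ω₀c
          (fun x ν => A ⟨castSite (fun j : Fin P.d => x (Fin.cast hPd j)), Fin.cast hPd.symm ν⟩) μ * (blockDiag g₀)ᵀ := by
    rw [hg₀_def]
    exact regionDeriv_gauge OrthFlow.rot e₀ ((ℓ + 1) ^ k) Ω₀c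
      (Ac := fun x ν => A ⟨castSite (fun j : Fin P.d => x (Fin.cast hPd j)), Fin.cast hPd.symm ν⟩)
      (σ := fun x => -((((ℓ + 1) ^ k : ℕ) : ℝ) * lam (castSite (fun j : Fin P.d => x (Fin.cast hPd j))))) hlink₀ μ
  have hDer : regionDeriv OrthFlow.rot e₀ ((ℓ + 1) ^ k) Ωc Ac' μ
      = blockDiag g * regionDeriv OrthFlow.rot e₀ ((ℓ + 1) ^ k) Ωc
          (fun x ν => A ⟨castSite (fun j : Fin P.d => x (Fin.cast hPd j)), Fin.cast hPd.symm ν⟩) μ * (blockDiag g)ᵀ := by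
    rw [hg_def]
    exact regionDeriv_gauge OrthFlow.rot e₀ ((ℓ + 1) ^ k) Ωc
      (Ac := fun x ν => A ⟨castSite (fun j : Fin P.d => x (Fin.cast hPd j)), Fin.cast hPd.symm ν⟩)
      (σ := fun x => -((((ℓ + 1) ^ k : ℕ) : ℝ) * lam (castSite (fun j : Fin P.d => x (Fin.cast hPd j))))) hlink μ
  have hres : (fun q : ↥(fineDom ((ℓ + 1) ^ k) Ωc) × Fin 2 => ((blockDiag g₀)ᵀ *ᵥ f) (incl hn hsub q.1, q.2))
      = (blockDiag g)ᵀ *ᵥ (fun q : ↥(fineDom ((ℓ + 1) ^ k) Ωc) × Fin 2 => f (incl hn hsub q.1, q.2)) := by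
    funext q
    obtain ⟨y, j⟩ := q
    show ((blockDiag g₀)ᵀ *ᵥ f) (incl hn hsub y, j) = _
    rw [blockDiagT_mulVec_apply, blockDiagT_mulVec_apply, hgg]
  have hfT : ∀ p : ↥(fineDom ((ℓ + 1) ^ k) Ω₀c) × Fin 2, ¬ S p.1 → ((blockDiag g₀)ᵀ *ᵥ f) p = 0 := by
    rintro ⟨y, j⟩ hy
    rw [blockDiagT_mulVec_apply]
    exact Finset.sum_eq_zero fun j' _ => by rw [hf (y, j') hy, mul_zero]
  rw [hop, hop₀, hDer, hDer₀, conj_inv hg, conj_inv hg₀, conj_deriv_green_mulVec hg, conj_deriv_green_mulVec hg₀,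
    gauge_pair_apply (hgg x)]
  refine (abs_gauge_mulVec_le hg x _ i).trans ?_
  have hE : 0 ≤ c₀ * Real.exp (-((D₀ + D₁) / (2 * ((((ℓ + 1) ^ k : ℕ) : ℝ) * K₀))))
      * Real.exp (-(D / (4 * ((((ℓ + 1) ^ k : ℕ) : ℝ) * K₀)))) := by positivity
  have hnT := norm_blockDiagT_mulVec_le hg₀ f
  simp only [Fintype.card_fin, Nat.cast_ofNat] at hnT
  have key := fun j' : Fin 2 =>
    (H' k hk1 hn a m2 ha1 ha2 hm1 hm2 Ω₀c Ωc hBU₀ hBU hsub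
      (fun x ν => A ⟨castSite (fun j : Fin P.d => x (Fin.cast hPd j)), Fin.cast hPd.symm ν⟩) e₀ he
      (hle.trans (min_le_right _ _)) hreg μ x hxμ hR S D D₀ D₁ hD hD₀ hD₁ _ hfT j').trans (mul_le_mul_of_nonneg_left hnT hE)
  rw [← hres]
  simp only [Pi.sub_apply, fld_apply]
  refine (Finset.sum_le_sum fun j' _ => key j').trans (le_of_eq ?_)
  simp only [Finset.sum_const, Finset.card_univ, Fintype.card_fin, nsmul_eq_mul, Nat.cast_ofNat]
  ring

/-- **THEOREM (1.11)–(1.12), HÖLDER member, ALL PAIRS, FOR `δG_k(Ω, Ω₀, u_k)` AT THE ACTUAL BACKGROUND, ARBITRARY SOURCE** — r01's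
`B4Thm112RegionAllF.thm112_holder_region_all_allF` transferred (pair `Ω ⊂ Ω₀`, points `x ≠ x′` of `Ω` with both `μ`-bonds in `Ω`, a
nearest-neighbour contour `Γ ⊂ Ω` from `x` to `x′`, the transporter `U(u_k(Γ))`, `R₀` at both points, any logarithm field `A′` of `u_k` on
`Ω₀`): `((ℓ+1)^k/|x′−x|_∞)^α·|U(D^ηu_Ω)(x′) − (D^ηu_Ω)(x) − (U(D^ηu₀)(x′) − (D^ηu₀)(x))|_i ≤ c₀·e^{−(D₀+D₁)/(2(ℓ+1)^kK₀)}·e^{−D/(4(ℓ+1)^kK₀)}·‖f‖_∞`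
with `u_Ω = G_k(Ω,u_k)(f|_Ω)`, `u₀ = G_k(Ω₀,u_k)f`.
[cite: BalabanImbrieJaffe1985, §7.3 p.326; Balaban1983RegularityDecay, Theorem (1.9), (1.11)–(1.12) p.573] -/
theorem thm112_holder_region_actualBg_allF {d ℓ : ℕ} (hd : 1 ≤ d) (hℓ : 1 ≤ ℓ) (hodd : Odd (ℓ + 1)) (pexp : ℝ) (n : ℕ)
    (amin aplus m2plus : ℝ) (ha : 0 < amin) (α : ℝ) (hα0 : 0 ≤ α) (hα1 : α < 1) :
    ∃ K₀ : ℕ, 16 ≤ K₀ ∧ 8 ∣ K₀ ∧ ∃ c₀ : ℝ, 0 < c₀ ∧ ∀ (c β : ℝ), 0 < c → 0 < β → β < 1 →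
      ∃ e₁ : ℝ, 0 < e₁ ∧ ∀ (P : Params) (hPd : P.d = d + 1), P.L = ℓ + 1 → ∀ (k : ℕ), 1 ≤ k → ∀ (hk : k ≤ P.m + P.K)
      (e₀ : ℝ), 0 < e₀ → e₀ ≤ e₁ →
      ∀ (v : U1Field P k), (∀ p : TPlaq P k, ‖((plaq v p : Circle) : ℂ) - 1‖ ≤ e₀ * (1 + Real.log e₀⁻¹) ^ pexp) →
      ∀ (lo hi : Fin P.d → ℤ), (∀ κ, hi κ ≤ lo κ + n) → n < P.sitesPerDir 0 →
      ∀ (Ω₀c Ωc : Finset (Fin (d + 1) → ℤ)), IsBlockUnion K₀ Ω₀c → IsBlockUnion K₀ Ωc → ∀ (hsub : Ωc ⊆ Ω₀c),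
        (∀ y ∈ Ω₀c, ∀ i : Fin (d + 1),
          lo (Fin.cast hPd.symm i) ≤ (P.L : ℤ) ^ k * y i ∧ (P.L : ℤ) ^ k * y i + (P.L : ℤ) ^ k ≤ hi (Fin.cast hPd.symm i)) →
      ∀ (Ac' : (Fin (d + 1) → ℤ) → Fin (d + 1) → ℝ),
        (∀ x ∈ fineDom ((ℓ + 1) ^ k) Ω₀c, ∀ ν : Fin (d + 1), x + e1 ν ∈ fineDom ((ℓ + 1) ^ k) Ω₀c →
          Circle.exp (e₀ / (((ℓ + 1) ^ k : ℕ) : ℝ) * Ac' x ν) =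
            actualBg ((Nat.succ_le_succ hd).trans_eq hPd.symm) k e₀ v
              ⟨castSite (fun j : Fin P.d => x (Fin.cast hPd j)), Fin.cast hPd.symm ν⟩) →
        ∀ (hn : 1 ≤ (ℓ + 1) ^ k) (a m2 : ℝ), amin ≤ a → a ≤ aplus → 0 ≤ m2 → m2 ≤ m2plus →
        ∀ (μ : Fin (d + 1)) (x x' : ↥(fineDom ((ℓ + 1) ^ k) Ωc)), x.1 + e1 μ ∈ fineDom ((ℓ + 1) ^ k) Ωc →
          x'.1 + e1 μ ∈ fineDom ((ℓ + 1) ^ k) Ωc → x'.1 ≠ x.1 →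
        ∀ (l : List ↥(fineDom ((ℓ + 1) ^ k) Ωc)), IsNNChain x l → pathEnd x l = x' →
          (l.length : ℝ) ≤ ((d : ℝ) + 1) * supNorm (x'.1 - x.1) →
          (∀ z ∈ l, supNorm (z.1 - x.1) ≤ supNorm (x'.1 - x.1)) →
          (∀ y : Fin (d + 1) → ℤ, (∀ ν, |y ν - blk ((ℓ + 1) ^ k) x.1 ν| ≤ (K₀ : ℤ) * (d + 4)) → y ∈ Ωc) →
          (∀ y : Fin (d + 1) → ℤ, (∀ ν, |y ν - blk ((ℓ + 1) ^ k) x'.1 ν| ≤ (K₀ : ℤ) * (d + 4)) → y ∈ Ωc) →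
        ∀ (S : ↥(fineDom ((ℓ + 1) ^ k) Ω₀c) → Prop) (D D₀ D₁ : ℝ), 0 ≤ D₀ → 0 ≤ D₁ →
          (∀ x'', S x'' → ∃ ν, D ≤ |rpos ((ℓ + 1) ^ k) Ω₀c (incl hn hsub x) ν - rpos ((ℓ + 1) ^ k) Ω₀c x'' ν|) →
          (∀ x'', S x'' → ∃ ν, D ≤ |rpos ((ℓ + 1) ^ k) Ω₀c (incl hn hsub x') ν - rpos ((ℓ + 1) ^ k) Ω₀c x'' ν|) →
          (∀ x₁ : ↥(fineDom ((ℓ + 1) ^ k) Ω₀c), ¬ inReg ((ℓ + 1) ^ k) Ωc x₁ →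
            ∃ ν, D₀ ≤ |rpos ((ℓ + 1) ^ k) Ω₀c (incl hn hsub x) ν - rpos ((ℓ + 1) ^ k) Ω₀c x₁ ν|) →
          (∀ x₁ : ↥(fineDom ((ℓ + 1) ^ k) Ω₀c), ¬ inReg ((ℓ + 1) ^ k) Ωc x₁ →
            ∃ ν, D₀ ≤ |rpos ((ℓ + 1) ^ k) Ω₀c (incl hn hsub x') ν - rpos ((ℓ + 1) ^ k) Ω₀c x₁ ν|) →
          (∀ x'', S x'' → ∀ x₁ : ↥(fineDom ((ℓ + 1) ^ k) Ω₀c), ¬ inReg ((ℓ + 1) ^ k) Ωc x₁ →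
            ∃ ν, D₁ ≤ |rpos ((ℓ + 1) ^ k) Ω₀c x₁ ν - rpos ((ℓ + 1) ^ k) Ω₀c x'' ν|) →
        ∀ (f : ↥(fineDom ((ℓ + 1) ^ k) Ω₀c) × Fin 2 → ℝ), (∀ p, ¬ S p.1 → f p = 0) →
        ∀ i : Fin 2,
          ((((ℓ + 1) ^ k : ℕ) : ℝ) / supNorm (x'.1 - x.1)) ^ α *
            |(transport (fieldLink OrthFlow.rot (e₀ / ((ℓ + 1) ^ k : ℕ)) (acBond Ωc Ac')) x l
                *ᵥ fld (regionDeriv OrthFlow.rot e₀ ((ℓ + 1) ^ k) Ωc Ac' μ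
                      *ᵥ ((regionOp OrthFlow.rot e₀ hn (B1.aSeq a ((ℓ : ℝ) + 1) k) m2 Ωc Ac')⁻¹
                        *ᵥ (fun q : ↥(fineDom ((ℓ + 1) ^ k) Ωc) × Fin 2 => f (incl hn hsub q.1, q.2)))) x'
              - fld (regionDeriv OrthFlow.rot e₀ ((ℓ + 1) ^ k) Ωc Ac' μ
                      *ᵥ ((regionOp OrthFlow.rot e₀ hn (B1.aSeq a ((ℓ : ℝ) + 1) k) m2 Ωc Ac')⁻¹
                        *ᵥ (fun q : ↥(fineDom ((ℓ + 1) ^ k) Ωc) × Fin 2 => f (incl hn hsub q.1, q.2)))) x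
              - (transport (fieldLink OrthFlow.rot (e₀ / ((ℓ + 1) ^ k : ℕ)) (acBond Ωc Ac')) x l
                  *ᵥ fld (regionDeriv OrthFlow.rot e₀ ((ℓ + 1) ^ k) Ω₀c Ac' μ
                        *ᵥ ((regionOp OrthFlow.rot e₀ hn (B1.aSeq a ((ℓ : ℝ) + 1) k) m2 Ω₀c Ac')⁻¹ *ᵥ f)) (incl hn hsub x')
                - fld (regionDeriv OrthFlow.rot e₀ ((ℓ + 1) ^ k) Ω₀c Ac' μ
                        *ᵥ ((regionOp OrthFlow.rot e₀ hn (B1.aSeq a ((ℓ : ℝ) + 1) k) m2 Ω₀c Ac')⁻¹ *ᵥ f)) (incl hn hsub x))) i|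
            ≤ c₀ * Real.exp (-((D₀ + D₁) / (2 * ((((ℓ + 1) ^ k : ℕ) : ℝ) * K₀))))
              * Real.exp (-(D / (4 * ((((ℓ + 1) ^ k : ℕ) : ℝ) * K₀)))) * ‖f‖ := by
  obtain ⟨K₀, hK16, h8, c₀, hc₀, H⟩ :=
    thm112_holder_region_all_allF OrthFlow.rot zero_le_one rot_lipschitz d ℓ hℓ amin aplus m2plus ha α hα0 hα1
  refine ⟨K₀, hK16, h8, 4 * c₀, by positivity, fun c β hc hβ0 hβ1 => ?_⟩
  obtain ⟨e₁', he₁', H'⟩ := H c β hc.le hβ0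
  obtain ⟨e₁, he₁, hall⟩ := exists_smooth_gauge_links hd hℓ hodd pexp n hβ1 hc
  refine ⟨min e₁ e₁', lt_min he₁ he₁', fun P hPd hPL k hk1 hk e₀ he hle v hv lo hi hbox hnN Ω₀c Ωc hBU₀ hBU hsub hΩ₀ Ac' hlog hn a m2
    ha1 ha2 hm1 hm2 μ x x' hxμ hx'μ hne l hl hlend hlen hlnear hRx hRx' S D D₀ D₁ hD₀0 hD₁0 hD hD' hD₀ hD₀' hD₁ f hf i => ?_⟩
  obtain ⟨lam, A, hreg, hlinks⟩ := hall P hPd hPL k hk1 hk e₀ he (hle.trans (min_le_left _ _)) v hv lo hi hbox hnN Ω₀c hΩ₀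
  have hlink₀ := hlinks Ac' hlog
  have hmono : fineDom ((ℓ + 1) ^ k) Ωc ⊆ fineDom ((ℓ + 1) ^ k) Ω₀c := fun z hz =>
    (mem_fineDom hn).mpr (hsub ((mem_fineDom hn).mp hz))
  have hlink : ∀ x ∈ fineDom ((ℓ + 1) ^ k) Ωc, ∀ ν : Fin (d + 1), x + e1 ν ∈ fineDom ((ℓ + 1) ^ k) Ωc →
      OrthFlow.rot.U (e₀ / (((ℓ + 1) ^ k : ℕ) : ℝ) * Ac' x ν)
        = OrthFlow.rot.U (e₀ / (((ℓ + 1) ^ k : ℕ) : ℝ) *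
            (A ⟨castSite (fun j : Fin P.d => x (Fin.cast hPd j)), Fin.cast hPd.symm ν⟩
              + -((((ℓ + 1) ^ k : ℕ) : ℝ) * lam (castSite (fun j : Fin P.d => x (Fin.cast hPd j))))
              - -((((ℓ + 1) ^ k : ℕ) : ℝ) * lam (castSite (fun j : Fin P.d => (x + e1 ν) (Fin.cast hPd j)))))) :=
    fun x hx ν hν => hlink₀ x (hmono hx) ν (hmono hν)
  obtain ⟨g₀, hg₀_def⟩ : ∃ g₀ : ↥(fineDom ((ℓ + 1) ^ k) Ω₀c) → Matrix (Fin 2) (Fin 2) ℝ, g₀ = fun u => OrthFlow.rot.U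
      (e₀ / (((ℓ + 1) ^ k : ℕ) : ℝ) * -((((ℓ + 1) ^ k : ℕ) : ℝ) * lam (castSite (fun j : Fin P.d => u.1 (Fin.cast hPd j))))) :=
    ⟨_, rfl⟩
  obtain ⟨g, hg_def⟩ : ∃ g : ↥(fineDom ((ℓ + 1) ^ k) Ωc) → Matrix (Fin 2) (Fin 2) ℝ, g = fun u => OrthFlow.rot.U
      (e₀ / (((ℓ + 1) ^ k : ℕ) : ℝ) * -((((ℓ + 1) ^ k : ℕ) : ℝ) * lam (castSite (fun j : Fin P.d => u.1 (Fin.cast hPd j))))) :=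
    ⟨_, rfl⟩
  have hg₀ : IsGauge g₀ := by rw [hg₀_def]; exact OrthFlow.rot.isGauge _
  have hg : IsGauge g := by rw [hg_def]; exact OrthFlow.rot.isGauge _
  have hgg : ∀ q : ↥(fineDom ((ℓ + 1) ^ k) Ωc), g q = g₀ (incl hn hsub q) := fun q => by rw [hg_def, hg₀_def]; rfl
  have hop₀ : regionOp OrthFlow.rot e₀ hn (B1.aSeq a ((ℓ : ℝ) + 1) k) m2 Ω₀c Ac'
      = blockDiag g₀ * regionOp OrthFlow.rot e₀ hn (B1.aSeq a ((ℓ : ℝ) + 1) k) m2 Ω₀c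
          (fun x ν => A ⟨castSite (fun j : Fin P.d => x (Fin.cast hPd j)), Fin.cast hPd.symm ν⟩) * (blockDiag g₀)ᵀ := by
    rw [hg₀_def]
    exact regionOp_gauge OrthFlow.rot e₀ hn (B1.aSeq a ((ℓ : ℝ) + 1) k) m2 Ω₀c
      (Ac := fun x ν => A ⟨castSite (fun j : Fin P.d => x (Fin.cast hPd j)), Fin.cast hPd.symm ν⟩)
      (σ := fun x => -((((ℓ + 1) ^ k : ℕ) : ℝ) * lam (castSite (fun j : Fin P.d => x (Fin.cast hPd j))))) hlink₀
  have hop : regionOp OrthFlow.rot e₀ hn (B1.aSeq a ((ℓ : ℝ) + 1) k) m2 Ωc Ac'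
      = blockDiag g * regionOp OrthFlow.rot e₀ hn (B1.aSeq a ((ℓ : ℝ) + 1) k) m2 Ωc
          (fun x ν => A ⟨castSite (fun j : Fin P.d => x (Fin.cast hPd j)), Fin.cast hPd.symm ν⟩) * (blockDiag g)ᵀ := by
    rw [hg_def]
    exact regionOp_gauge OrthFlow.rot e₀ hn (B1.aSeq a ((ℓ : ℝ) + 1) k) m2 Ωc
      (Ac := fun x ν => A ⟨castSite (fun j : Fin P.d => x (Fin.cast hPd j)), Fin.cast hPd.symm ν⟩)
      (σ := fun x => -((((ℓ + 1) ^ k : ℕ) : ℝ) * lam (castSite (fun j : Fin P.d => x (Fin.cast hPd j))))) hlink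
  have hDer₀ : regionDeriv OrthFlow.rot e₀ ((ℓ + 1) ^ k) Ω₀c Ac' μ
      = blockDiag g₀ * regionDeriv OrthFlow.rot e₀ ((ℓ + 1) ^ k) Ω₀c
          (fun x ν => A ⟨castSite (fun j : Fin P.d => x (Fin.cast hPd j)), Fin.cast hPd.symm ν⟩) μ * (blockDiag g₀)ᵀ := by
    rw [hg₀_def]
    exact regionDeriv_gauge OrthFlow.rot e₀ ((ℓ + 1) ^ k) Ω₀c
      (Ac := fun x ν => A ⟨castSite (fun j : Fin P.d => x (Fin.cast hPd j)), Fin.cast hPd.symm ν⟩)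
      (σ := fun x => -((((ℓ + 1) ^ k : ℕ) : ℝ) * lam (castSite (fun j : Fin P.d => x (Fin.cast hPd j))))) hlink₀ μ
  have hDer : regionDeriv OrthFlow.rot e₀ ((ℓ + 1) ^ k) Ωc Ac' μ
      = blockDiag g * regionDeriv OrthFlow.rot e₀ ((ℓ + 1) ^ k) Ωc
          (fun x ν => A ⟨castSite (fun j : Fin P.d => x (Fin.cast hPd j)), Fin.cast hPd.symm ν⟩) μ * (blockDiag g)ᵀ := by
    rw [hg_def]
    exact regionDeriv_gauge OrthFlow.rot e₀ ((ℓ + 1) ^ k) Ωc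
      (Ac := fun x ν => A ⟨castSite (fun j : Fin P.d => x (Fin.cast hPd j)), Fin.cast hPd.symm ν⟩)
      (σ := fun x => -((((ℓ + 1) ^ k : ℕ) : ℝ) * lam (castSite (fun j : Fin P.d => x (Fin.cast hPd j))))) hlink μ
  have hT : transport (fieldLink OrthFlow.rot (e₀ / ((ℓ + 1) ^ k : ℕ)) (acBond Ωc Ac')) x l
      = g x * transport (fieldLink OrthFlow.rot (e₀ / ((ℓ + 1) ^ k : ℕ))
          (acBond Ωc fun x ν => A ⟨castSite (fun j : Fin P.d => x (Fin.cast hPd j)), Fin.cast hPd.symm ν⟩)) x l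
          * (g x')ᵀ := by
    rw [hg_def, ← hlend]
    exact transport_acBond_gauge OrthFlow.rot e₀ ((ℓ + 1) ^ k) Ωc
      (Ac := fun x ν => A ⟨castSite (fun j : Fin P.d => x (Fin.cast hPd j)), Fin.cast hPd.symm ν⟩)
      (σ := fun x => -((((ℓ + 1) ^ k : ℕ) : ℝ) * lam (castSite (fun j : Fin P.d => x (Fin.cast hPd j))))) hlink x l hl
  have hres : (fun q : ↥(fineDom ((ℓ + 1) ^ k) Ωc) × Fin 2 => ((blockDiag g₀)ᵀ *ᵥ f) (incl hn hsub q.1, q.2))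
      = (blockDiag g)ᵀ *ᵥ (fun q : ↥(fineDom ((ℓ + 1) ^ k) Ωc) × Fin 2 => f (incl hn hsub q.1, q.2)) := by
    funext q
    obtain ⟨y, j⟩ := q
    show ((blockDiag g₀)ᵀ *ᵥ f) (incl hn hsub y, j) = _
    rw [blockDiagT_mulVec_apply, blockDiagT_mulVec_apply, hgg]
  have hfT : ∀ p : ↥(fineDom ((ℓ + 1) ^ k) Ω₀c) × Fin 2, ¬ S p.1 → ((blockDiag g₀)ᵀ *ᵥ f) p = 0 := by
    rintro ⟨y, j⟩ hy
    rw [blockDiagT_mulVec_apply]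
    exact Finset.sum_eq_zero fun j' _ => by rw [hf (y, j') hy, mul_zero]
  have hw : 0 ≤ ((((ℓ + 1) ^ k : ℕ) : ℝ) / supNorm (x'.1 - x.1)) ^ α :=
    Real.rpow_nonneg (div_nonneg (Nat.cast_nonneg _) (supNorm_nonneg _)) α
  rw [hop, hop₀, hDer, hDer₀, hT, conj_inv hg, conj_inv hg₀, conj_deriv_green_mulVec hg, conj_deriv_green_mulVec hg₀,
    gauge_holderPair hg hg₀ (hgg x) (hgg x')]
  have hE : 0 ≤ c₀ * Real.exp (-((D₀ + D₁) / (2 * ((((ℓ + 1) ^ k : ℕ) : ℝ) * K₀))))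
      * Real.exp (-(D / (4 * ((((ℓ + 1) ^ k : ℕ) : ℝ) * K₀)))) := by positivity
  have hnT := norm_blockDiagT_mulVec_le hg₀ f
  simp only [Fintype.card_fin, Nat.cast_ofNat] at hnT
  have key := fun j' : Fin 2 =>
    (H' k hk1 hn a m2 ha1 ha2 hm1 hm2 Ω₀c Ωc hBU₀ hBU hsub
      (fun x ν => A ⟨castSite (fun j : Fin P.d => x (Fin.cast hPd j)), Fin.cast hPd.symm ν⟩) e₀ he
      (hle.trans (min_le_right _ _)) hreg μ x x' hxμ hx'μ hne l hl hlend hlen hlnear hRx hRx' S D D₀ D₁ hD₀0 hD₁0 hD hD' hD₀ hD₀'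
      hD₁ _ hfT j').trans (mul_le_mul_of_nonneg_left hnT hE)
  refine (mul_le_mul_of_nonneg_left (abs_gauge_mulVec_le hg x _ i) hw).trans ?_
  rw [Finset.mul_sum, ← hres]
  refine (Finset.sum_le_sum fun j' _ => key j').trans (le_of_eq ?_)
  simp only [Finset.sum_const, Finset.card_univ, Fintype.card_fin, nsmul_eq_mul, Nat.cast_ofNat]
  ring

end Thm112DH

end

end Literature.MathematicalPhysics.QuantumFieldTheory.BalabanImbrieJaffe1984to88.BIJ85RegionPropagatorsActualBgMembers
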